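import Mathlib
import HarnessLib
import HarnessLib.Audit
import Summits.AtomisticToContinuum.Statement
import Literature.MathematicalPhysics.KineticTheory.LangevinChainKernel
import Literature.MathematicalPhysics.KineticTheory.LangevinChainNESSHolds
import Literature.MathematicalPhysics.KineticTheory.LangevinChainGibbs
import Summits.AtomisticToContinuum.FouriersLaw.Theorems.EmbeddedDrudeMourreNessUnique
import HarnessLib.Audit.Status.Attr

/-!
Route: OddSectorIrreversibility

DORMANT since 2026-08-26T10:15:17Z (reconciler: no traction for 8.4 d (last activity item-evidence-added at 2026-08-18T00:41:32Z); parked, not closed — `ledger route dormant route-AtomisticToContinuum-OddSectorIrreversibility --off` to ) — unstaffed, not closed; items shared with open routes are served there. `ledger route dormant <id> --off` reactivates.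

# Route OddSectorIrreversibility — the odd Kubo corrector of a deterministic conductor carries the
causal-cone transport; pair it with the CLOSED chain's cone-windowed transport witness (aligned
Cauchy–Schwarz) ⇒ bounded response ⇒ FouriersLaw; the NESS's arrow of time is INTENSIVE, b_N = O(δ²)
(rev 4: re-routed after the locality negative lemma; rev 11: crux-only deciding theorem —
WitnessGlue promoted to the transport-witness THEOREM, NessUnique and FiniteResponseOfUnique
re-badged crux; rev 17: E3 route-choice — the held, misstated TANGENT cone E3 is replaced by the
TAP-LEAK BUDGET P = TapLeakBound that the witness actually consumes, to be split into a
RESAMPLED-kick cone C′ (capped differences, linear window, order-3 tail) and boundary Hermite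
regularity H1 of the even corrector, the leak being re-routed by Gaussian integration by parts in
the contact momenta)

X = E1 ∧ E2 ∧ P ∧ (import slot BRC), over a fixed-N corrector calculus; P ⇐ H1 ∧ C′ (foreseen glued
split, fixed-N Gaussian IBP). Notation: pinnedChain ω₂ lam β γ (all > 0), T > 0;
μ_T = e^{−H_N/T}dqdp (unnormalised Gibbs weight, mass Z; π := μ_T/Z = μ_{N,T,T} under NessUnique +
GibbsSteadyState);
P_t = transitionKernel N T T t (equilibrium OPEN kernels); Φ_t = the CLOSED Hamiltonian flow =
(pinnedChain ω₂ lam β 0).transitionKernel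
(zero friction ⇒ zero noise, same H); J = J_tot = Σ_i j_i; Θ(q,p) = (q,−p); u = u_N := lim_τ ∫₀^τ
P_tJ dt the Kubo corrector
(L u = −J; exists, C¹, L²-limit: CorrectorTheory), u^∓ := (u ∓ u∘Θ)/2; D_N the response coefficient
of clause (ii);
d_i = distance (in bonds) of bond i to the nearer contact; σ² ≈ 2κ_GK T² the current noise strength,
v_B the butterfly speed;
𝒩_b := −T∂²_{p_b} + p_b∂_{p_b} the Ornstein–Uhlenbeck tap operator at contact b (L = A − γΣ_b𝒩_b, A
the Liouvillian), Π_b g(q,p) := ∫ g(q, p[b↦p′]) dN(0,T)(p′)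
the resampling of the contact momentum (= μ_T-conditional expectation over p_b).
REV-4 PIVOT (route-choice seat, 2026-08-16). The rev 1–3 engine OddCorrectorDecay (∫₀^∞‖P_tJ −
(P_tJ)∘Θ‖dt ≤ C‖J‖) is FALSE
modulo the standard L²(μ_T) dictionary + fixed-time locality (negative lemma
Summit.AtomisticToContinuum.FouriersLaw.Theorems.OddSectorLocality.oddCorrectorDecay_false_of_oddSectorLocalityHypothesis,
FalseOfLocality.lean):
the bulk is deterministic, hence L²(μ_T)-unitary, and the two contact taps need t ≍ N/v to erase
half of ‖J‖² (t_½(N) ≈ N/2 measured).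
The SAME count kills the rev 1–3 X, SI = OddResponseBound (N∫(h−hΘ)² ≤ C), and the pre-registered
pivot SI′ (‖P_odd u‖² = O(N)):
h − hΘ = (u − uΘ)/((N−1)T²) (OddDensityIsCorrector) with (u − uΘ)(x) = E[∫_ℝ J(X_t)dt | X_0 = x],
and for a deterministic bulk the
two-sided transport inside the causal window |t| ≲ N/v_B is X_0-measurable, so Einstein–Helfand
gives ‖u − uΘ‖²_π ≍ N², ∫(h−hΘ)²dπ ≍ 1,
a_N := N∫(h−hΘ)² ≍ N (Cruxes/OddResponseBound/Disproof.lean §3; twin-history numerics kit j008646: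
a_N = 25/100/375 at N = 8/16/32,
(1,1,1,1), T = 1; 0.14/0.40/0.75 at the diffusive point (1,1,0.1,1), T = 8). Corrected order
parameter: b_N = KL(NESS‖Θ NESS) ≍
δ²·{N ballistic | N⁰ deterministic diffusive | N⁻¹ stochastic-bulk diffusive}; the rev-1 benchmarks
(BLL self-consistent baths,
velocity flips) were the third class. The dead decls stay in the file as settled-negative SUPPORT
edges (9140: Negative lemma EchoFloor
p73549 landed; 9139 dropped at rev 16 after ¬OddCorrectorDecay landed; since rev 17 also the typed
E3, below) and are NOT hypotheses of `closes`.
REV-17 ROUTE-CHOICE (seat 4801cdfb, 2026-08-16; unanimous recommendation of the line lead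
(Cruxes/ClosedConeSensitivity/MISSTATED.md §4,
Restatement.lean), the standing disprover (Disproof.lean §4 (R2)), five ideators and six triage
files): the rev-4 crux E3 = ClosedConeSensitivity
carries C·s² for EVERY s ∈ (0,1] and is therefore — Fatou along s = 1/(n+1), landed as
Theorems/ClosedConeSensitivity/Negative/TangentReduction.tangentBoundAt_of_closedConeSensitivity
(p82694) — an N-uniform L²(Gibbs) bound on the TANGENT
entry ∂_{p_b}(j_i∘Φ_t) on linear rays, judged false at every admissible parameter point (hot quartic
clusters stretch at rate
λ(e) ≈ 0.05·e^{1/4}, unbounded, at a Gibbs price e^{−ke/T} independent of d; hyperbolic end-tube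
amplifiers; kit j012710/j012754/j014142:
top 1 % of samples carry 82–97 % of the tangent mean square); its negation needs TangentRayBlowup,
not constructible either ⇒ E3 is HELD and
demoted to a settled-negative support edge (item 14059 re-attached as support, decl kept verbatim:
the Negative lane unfolds it), and its crux slot
(rank 4) now carries P = TapLeakBound, the tap-leak budget itself: |T⟨∂_{p_b}u⁺,
∂_{p_b}(j_i∘Φ_s)⟩_{μ_T}| ≤ C√((|⟨u,J⟩_{μ_T}| + Z)·Z)·(1 + d − s/a)^{−3/2}
for s ≤ a·d — a PAIRING, not a norm: the amplifier-exposed tangent entry is integrated against the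
p_b-smooth weight ∂_{p_b}u⁺e^{−H/T}. Its planned proof
re-routes the leak OFF the flow: T⟨∂_{p_b}u⁺, ∂_{p_b}g⟩_{μ_T} = ⟨𝒩_b u⁺, (I − Π_b)g⟩_{μ_T} (Gaussian
integration by parts with the resampling projection,
fixed N), so only CAPPED resampling differences of g = j_i∘Φ_s (child C′ = ResampledKickCone, immune
to amplifiers, which then enter only through their
LIFETIME law) and two p_b-derivatives of the noise-averaged even corrector (child H1 =
BoundaryHermiteRegularity; the first derivative is free by the tap
identity) are needed; the order 3/2 of P (order 3 of C′) is exactly what the bookkeeping consumes.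
Both children are typed and elaborate (planner
Sketch.lean); they are filed by `route edit --split TapLeakBound` (second layer — the 15 top-level
slots are full).
THE SURVIVING LINE (crux idea Cruxes/OddCorrectorDecay/Ideas/transport-witness-windowed-gk.md,
re-derived here with a CLOSED-flow
witness, no path space). Pair the odd corrector u⁻ not with J (misaligned by √N: ‖u⁻‖ ≍ N while ⟨u⁻,
J⟩_π = ⟨u, J⟩_π = (N−1)T²D_N)
but with the cone-shaped windowed transport of the ISOLATED chain, W := Σ_i [w_i − w_i∘Θ], w_i :=
∫₀^{τ_i} j_i∘Φ_t dt, τ_i ≍ a·d_i.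
Three exact fixed-N identities (CorrectorTheory: bond sum rule ⟨u, j_i⟩_π = ⟨u, J⟩_π/(N−1) = T²D_N
via its Green–Kubo conjunct (= KuboAbelIdentity, stmt-13419 verbatim);
parity split of Lu = −J, even part A u⁻ = −S u⁺ with A the Liouvillian and S the two
Ornstein–Uhlenbeck taps; Gaussian integration by
parts in p_0, p_{N−1}) give d/dt⟨u⁻, j_i∘Φ_t⟩_π = −γT Σ_b ⟨∂_{p_b}u⁺, ∂_{p_b}(j_i∘Φ_t)⟩_π [= −γ Σ_b
⟨𝒩_b u⁺, (I − Π_b)(j_i∘Φ_t)⟩_π], bounded by P as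
γC√(1 + (N−1)T²|D_N|)·(1 + d_i − t/a)^{−3/2} inside the light cone (the first-order budget
Σ_b‖∂_{p_b}u‖²_π = ⟨u, J⟩_π/(γT) = (N−1)T D_N/γ is exact),
so the pairing sits on the Green–Kubo plateau T²D_N and
    2T²D_N·Σ_N − O(N²·√D_N) ≤ ⟨u⁻, W⟩_π ≤ ‖u⁻‖_π·‖W‖_π,   Σ_N := Σ_i τ_i ≍ aN²/16
(TRANSPORT-WITNESS INEQUALITY; the leak
Σ_i τ_i ∫₀^{τ_i} |leak rate| ds ≲ √(N D_N)·a²Σ_i d_i^{2−m/2} is O(N²√D_N) iff the order m of the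
squared tail is ≥ 3, i.e. P's 3/2).
With ‖u⁻‖ ≤ ‖u‖ ≤ √C₁·N (E1: the causal-cone scale — the TRUE scale; harmonic member N^{3/2}) and
‖W‖ ≤ const·√(C₂a)·N
(E2 on dyadic time shells of central blocks; harmonic member N^{3/2}·√log) the Cauchy–Schwarz is
ALIGNED (both sides ≍ N²):
0 ≤ D_N ≤ A + B√D_N with A = const·√(C₁C₂/a)/T², i.e. sup_N D_N < ∞ = BoundedResponse (WitnessGlue);
then BRC ⇒ D_N → κ(T) > 0 and FouriersLaw (closes,
PROVED). Reading: "open-chain response ≤ windowed Green–Kubo of the closed chain" — the INEQUALITY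
form of the practitioners'
finite-time cut-off t_c ∼ L (KunduDharNarayan2009 p. 2: 'no rigorous justification';
Lepri–Livi–Politi 2003), with the corrector's
cone-scale bound as the price of rigour; no κ = κ_GK identification, no infinite volume, no L¹ tail
of the autocorrelation.
The namesake survives, corrected: E1 + OddDensityIsCorrector ⇒ sup_N ∫(h_N − h_N∘Θ)² dπ < ∞, i.e.
the
static arrow of time of a deterministic Fourier conductor is INTENSIVE (O(δ²) nats by
ReversalKLSecondOrder), strictly between
ballistic (≍ Nδ²) and stochastic-bulk (≍ δ²/N) — the odd sector of the NESS is exactly the forecast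
of the causal window's transport.
Lean: `ConeScaleCorrector ∧ SubBallisticWindow ∧ TapLeakBound ∧ BoundedResponseConverges`

## Assembly
REV 17 (route-choice seat 4801cdfb, 2026-08-16; crux-only deciding theorem of rev 11 kept — D-0027
§2.1 as sharpened 2026-08-16: `closes`
may assume CRUX items only, glue and supports are proved LEMMAS). WitnessGlue is the
TRANSPORT-WITNESS THEOREM
`TapLeakBound → ConeScaleCorrector → SubBallisticWindow → BoundedResponse` (crux, rank-9 slot;
restated in place from the rev-11 E3 form): its
fixed-N antecedents are LEMMAS beneath it (CorrectorTheory A(1)–(7)+B with six helper files landed;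
GibbsSteadyState PROVED), weak-NESS uniqueness is
BoundedResponse's own antecedent. Deciding theorem `theorem closes (hW : WitnessGlue) (hP :
TapLeakBound) (hE1 : ConeScaleCorrector)
(hE2 : SubBallisticWindow) (hU : NessUnique) (hF : FiniteResponseOfUnique) (hBC :
BoundedResponseConverges) : FouriersLaw` — seven hypotheses, all
cruxes — PROVED sorry-free (planner Sketch.lean `closesP`, lean check rc 0, 0 sorry, axioms
propext/Classical.choice/Quot.sound): clause (i) from
pinnedChain_exists_isSteadyState (PROVED) + NessUnique; canonical family by choice; D_N from
FiniteResponseOfUnique; BoundedResponse from WitnessGlue at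
(P, E1, E2); bounded ⇒ convergent-positive by BRC; κ := the limit; other families agree for |δ| < 2T
by uniqueness. Assembly (item) restated 1:1 to the
new chain (= the type of `closes`; Theorems/OddSectorIrreversibilityAssembly.lean `unfold Assembly;
exact closes` re-elaborates verbatim and re-closes it).
Why ONE new top-level crux and not two (C′, H1): the 15 top-level slots are full (every decl of the
file is referenced in code by landed Theorems files —
the Negative lanes, EchoFloor, the bridges — so none can be dropped; the assembly item cannot be
dropped; the gate's retriage path currently fails on
this route, so kinds cannot be re-badged), hence P = the leak budget WitnessGlue consumes is the
top-level crux and C′, H1 are its second layer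
(`route edit --split TapLeakBound --into children.json --glue 'BoundaryHermiteRegularity →
ResampledKickCone → TapLeakBound'`, statements in the
planner's children.json / Sketch.lean, attached as evidence on the P item). Prover entry points,
cheapest first: CorrectorTheory (fixed N; its
Green–Kubo conjunct is StaticAbelianSqueeze.KuboAbelIdentity verbatim), the fixed-N Gaussian IBP
identity with resampling projection
(GaussianIBPProjection′, MemLp hypotheses per TRIAGE-r1-2 App. A) and 'corrector ∈ C²' as
`--supports TapLeakBound` lemmas, WitnessGlue's bookkeeping
(seven helper files landed under stmt-14072/15120:
Theorems/OddSectorIrreversibilityWitnessGlue{Core,ClosedFlow,Kernels,Leak,Pairing,Reflection,Tangent}.lean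
—
the E3-specific tangent step is superseded: the leak rate is now bounded by P directly), then P via
H1 (harmonic member automatic, C = 2/γ) and C′ (lines
ready: Cruxes/ClosedConeSensitivity/Ideas/supersonic-hot-chain-ldp.md cone side,
stationary-exceedance-cold-cone.md provable floor,
gaussian-ibp-resampled-kick.md consumer side), E2, E1.
KNOWN BUILD DEBT after rev 17 (one line each, any prover / operator): (a)
Theorems/OddSectorIrreversibilityBoundedResponseBridges.lean —
`boundedResponse_of_witnessGlue` and `boundedResponse_of_witnessGlue_cruxes` must take `(hP :
OddSectorIrreversibility.TapLeakBound)` in place of `hE3`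
and read `hW hP hE1 hE2`; (b) PRE-EXISTING since rev 16 (drop of OddCorrectorDecay):
Theorems/OddSectorIrreversibilityOddCorrectorDecayRefutation.lean and
Theorems/OddCorrectorDecay/Negative/FalseOfLocality.lean (lean check rc 1: unknown constant
OddSectorIrreversibility.OddCorrectorDecay) and
…OddCorrectorDecayBathReduction.lean reference the dropped decl — point them at
`StaticIrreversibility.OddCorrectorDecay` (same statement, still in the tree);
(c) gate: `route edit --retriage` fails on this route (its render omits `def WitnessGlue`; three
attempts 2026-08-16T09:3x–09:5xZ) — operator.
Item budget (rev 17): 15 top-level = 7 cruxes (E1, E2, P, BRC, WitnessGlue, NessUnique ✓,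
FiniteResponseOfUnique) + 5 supports (CorrectorTheory,
GibbsSteadyState ✓, BoundedResponse, ResponseDensity, OddDensityIsCorrector) + 2 settled-negative
edges (ClosedConeSensitivity held, OddResponseBound) + 1
assembly; second layer (to be filed): H1, C′ under P.

Rationale: WHY THIS LINE. Every FouriersLaw route must pass
Literature.Barriers.AtomisticToContinuum.HasBoundedResponse (necessity PROVED,
hasBoundedResponse_of_fouriersLawFor), and BLR2000 §6.3 names the missing input: "some information
on the dependence of D on L … on
the decay of correlations". Rev 1–3 tried to get it from parity alone (N-uniform decay in the Θ-odd
sector): refuted in substance at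
every parameter point by CAUSALITY — forecasts of an L²(μ_T)-unitary bulk keep their norm until the
contact taps reach them
(FalseOfLocality: F_N² = 2‖P_tJ‖² + 2⟨J, P_2tJ⟩, Fejér positivity, t_½(N) ≈ N/2), and the present
microstate predicts the signed
transport of a whole causal window, so even the resolvent / NESS forms SI′ / SI sit a factor N below
the true size of the odd
corrector (9140 Disproof §3; mechhunt g3-0; 9139 ideator 1; this seat; twin-history numerics a_N ≍
N). What the autopsy leaves
standing is sharper than what died: (1) the McLennan / KDN corrector calculus (u, the bond sum rule,
the parity identity
A u⁻ = −S u⁺, the tap energy identity) is sound and fixed-N; (2) the ONLY misstep was the misaligned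
pairing ⟨u⁻, J⟩ — Cauchy–Schwarz
loses √N because u is spread over the cone history and J is not; (3) pairing with the cone-shaped
two-sided windowed transport W of
the CLOSED chain is aligned and turns bounded response into three statements AT TRUE SCALE, of three
different types, each
visibly false at lam = β = 0 with the right exponent: E1 an open-chain equilibrium RESOLVENT bound
on ONE explicit vector at the
causal scale (‖L⁻¹J‖² ≲ N·‖J‖²; harmonic: N³, band-edge phonons survive many crossings), E2 a
closed-chain equilibrium FLUCTUATION
CEILING for windowed block transport (harmonic: (k₂−k₁)²τ log τ, ballistic), P the TAP-LEAK BUDGET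
of the witness pairing — rev 17 successor of E3, whose DERIVATIVE form (an annealed tangent cone,
TangentReduction
p82694) is not kinematic for quartic forces and is held as misstated — planned as resampled locality
of the closed flow (C′) × boundary Hermite
regularity of the noise-averaged even corrector (H1), glued by Gaussian integration by parts in the
contact momentum (harmonic member automatic). Imported areas: open-system linear response /
Green–Kubo (KunduDharNarayan2009
(reln1)–(reln3), MaesNetocny2010), Einstein–Helfand and the finite-time Green–Kubo practice
(doi:10.1016/S0370-1573(02)00558-6,
Dhar2008), propagation bounds for anharmonic lattices (MarchioroPellegrinottiPulvirenti1978,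
doi:10.1007/s10955-007-9278-0,
ButtaMarchioro2016), fixed-N hypoelliptic theory (CuneoEckmannHairerReyBellet2018). What other
routes do not do: FourierGreenKubo
needs κ = κ_GK with an infinite-volume L¹ tail of the FULL autocorrelation; StaticAbelianSqueeze
squeezes the resolvent at ν > 0 by
infinite-chain variational statics and still needs UniformAbelianRegularity; BoundaryEscapeDeficit /
GriffithsLimitExchange work
with exit laws of a boundary kick; HonestZwanzig with a Feshbach memory kernel; none pairs the OPEN
corrector with a CLOSED-chain
witness, and none isolates the N-uniform content as "one resolvent norm at causal scale + one
finite-window variance ceiling +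
one tap-leak budget (resampled locality of the closed flow × boundary regularity of the corrector)".
The negative lemma's dictionary H (Gibbs invariance under the kernels, Θ-detailed balance L† = ΘLΘ)
is now a RESOURCE:
it is exactly the fixed-N input of CorrectorTheory, so the T0 construction of H serves the pending
refutations and this line alike.
RANKED CRUXES. #2 ConeScaleCorrector (E1, crux) — ∃ C(T) ∀ N: ‖u_N‖²_{L²(μ_T)} ≤ C·N²·Z for every
a.e.-limit u_N of the
finite-horizon correctors (existence: CorrectorTheory; ‖J‖² ≍ N·Z, so this is ‖L⁻¹J‖ ≲ √N‖J‖). True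
scale N²·Z: the deterministic two-sided cone transport has
Var ≍ σ²·N·N/v_B; the claim is that NOTHING MORE survives — boundary noise + bulk chaos scramble the
microstate within O(1) causal
crossings. Hardest and most informative: an ergodic-type statement on deterministic dynamics
compressed into one resolvent norm,
compatible with gaps closing like N⁻³ since it concerns ONE vector. Exact fixed-N reformulations
(promote seat 2026-08-16; CorrectorTheory-level facts): (α) REPLICA GREEN–KUBO
‖u_τ‖²_π = E[Q_τ Q′_τ] ≤ Var_π(Q_τ) (Q_τ = ∫₀^τ J_tot(X_t)dt; two open replicas from ONE Gibbs point
with independent tap noises;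
conditional Jensen) — the estimator the kit jobs print; (β) DYNKIN SPLIT u = u_τ + P_τ u (u(X_t) +
Q_t is a martingale), so u − u_τ is
the forecast of the transport still to come after τ; (γ) TAP DRAIN ‖u‖² − ‖P_τu‖² = 2γT∫₀^τ
Σ_b‖∂_{p_b}P_s u‖² ds with initial rate
2⟨u, J⟩ = 2(N−1)T²D_N·Z ≍ N·Z — one crossing time τ ≍ N can drain ≍ N²·Z, exactly E1's budget, no
slack either way. Mechanism with a
MEASURED scale: behind a ballistic chaos front (butterfly speed v_B; classical OTOC light cones
DasEtAl2018; for a PINNED chain with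
purely quartic coupling between Langevin baths (FSW / Klein–Gordon class, weak disorder Δ = 0.1)
KumarEtAl2020 §V pp. 7–9, 'chaos
propagation is always ballistic', (v_B, λ_max) ≈ (0.12, 0.046) measured at T = 0.04) two replicas
with the same X_0 and independent tap noises desynchronise, after which only the hydrodynamic
(energy-profile) forecast survives, whose
share of ‖u‖²/Z is ≈ Σ_k (κπk/(c_vN))²·Var(a_k)·λ_k⁻² = Σ_k 2χN/(π²k²) ≈ χN/3 ≪ N² (open-chain heat
modes λ_k = κπ²k²/(c_vN²),
mode amplitudes Var(a_k) = 2χ/N, χ = c_vT²). First glued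
split TYPED with the composition PROVED to the route decl (evidence SketchE1Children.lean on
stmt-14069, lean check rc 0, 0 sorry):
E1 ⇐ ConeTransportBudget (‖u_τ‖² ≤ C·N·(1+τ)·Z ∀ τ ≥ 0 — E2's open twin) + PostCrossingForecast (∃ a
> 0: ‖u − u_{aN}‖² ≤ C·N²·Z —
the ergodic child); both children fail at lam = β = 0 with exponent 3. Refuter crux-attack
2026-08-16 (rattack-14069): SURVIVES —
N ≤ 1 slice proved true, strengthening to C·N·Z heuristically false, N² confirmed as the right
scale, not a restatement. #3 SubBallisticWindow (E2, crux) — ∃ C ∀ N, blocks [k₁,k₂),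
τ ≥ 0: ‖∫₀^τ J_{[k₁,k₂)}∘Φ_t dt‖²_{L²(μ_T)} ≤ C(1+τ)(k₂−k₁)·Z for the CLOSED chain: at most
diffusive (Einstein–Helfand) growth of
windowed block transport, an upper bound only; large τ is harmless (j_i = d/dt E_{>i} along Φ, the
window integral is a bounded energy
difference), the content is 1 ≪ τ ≲ N. READING (heat-diffusion theory: LiuEtAl2014 eq. (3),
WangLiHanggi2016 §6.2.1 eq. (6.23),
Helfand1960): d²⟨Δx²(t)⟩_E/dt² = 2C_JJ(t)/(k_BT²c_v), so a windowed Green–Kubo second moment IS an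
energy-spreading mean-square
displacement and E2 is the finite-N, finite-block, UPPER-bound-only form of 'energy does not spread
superdiffusively (MSD exponent ≤ 1)'
— numerically normal for φ⁴-type pinned lattices ('the φ⁴ lattice shows normal energy diffusion',
WangLiHanggi2016 §6.2.1.2 Fig. 6.11;
Zhao2006), superdiffusive ≍ t^{1.40} with Lévy-walk sound peaks only for momentum-CONSERVING
lattices (ibid. §6.2.1.3), never proved
for any deterministic anharmonic chain. #4 TapLeakBound (P, crux, rev 17; takes the slot of the held
E3 — restatement menu MISSTATED.md §4 / Disproof §4 (R2) / Restatement.lean, filed as the ONE new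
top-level crux the budget allows) — ∃ a, C ∀ N, bond i, contact b ∈ {0, N−1}, the C¹ ∩ L² a.e.-limit
u of the finite-horizon correctors (= u_N), s ∈ [0, a·d]: |T∫∂_{p_b}u⁺·∂_{p_b}(j_i∘Φ_s) dμ_T| ≤
C√((|∫u·J dμ_T| + Z)·Z)·(1 + d − s/a)^{−3/2} (= C·Z√(1 + (N−1)T²|D_N|)·(1 + d − s/a)^{−3/2}): the
leak rate of the transport-witness pairing through tap b, N-uniformly, with the polynomial order the
bookkeeping needs (3/2 ⇔ order 3 on squares; exactly marginal: Σ_d d^{1/2} ≍ N^{3/2}). A PAIRING of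
the amplifier-exposed tangent entry against the p_b-smooth weight ∂_{p_b}u⁺e^{−H/T}, not a norm.
FORESEEN GLUED SPLIT (typed, planner Sketch.lean rc 0; children.json attached to the item): P ⇐ H1 +
C′ with glue 'BoundaryHermiteRegularity → ResampledKickCone → TapLeakBound' (fixed-N Gaussian IBP
T∫∂_b f∂_b g dμ_T = ∫(𝒩_b f)(g − Π_b g)dμ_T, ∫(g − Π_b g)² = ∫resampleVar_b g, + Cauchy–Schwarz). C′
= ResampledKickCone: ∃ a, C: ∫ ½∫(j_i(Φ_t(q, p[b↦p′])) − j_i(Φ_t(q,p)))² dN(0,T)(p′) dμ_T ≤ C(1 + d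
− t/a)^{−3}Z for t ≤ a·d — CAPPED differences (no s², no s → 0; immune to the source / tube
amplifiers, which enter only through their LIFETIME law), linear window, polynomial tail of FIXED
order 3 (∀m refutable: Arrhenius receivers give d^{−1/α}, TRIAGE-r2-1 B.4; never exponential); t = 0
exact, free Gibbs second moment on the ray; constants ρ = β/lam-dependent. H1 =
BoundaryHermiteRegularity: ∃ C: for u as above (C²), 𝒩_b u⁺ ∈ L² and ‖𝒩_b u⁺‖² ≤ C(|∫uJ| + Z) — the
p_b-dependence of the even corrector sits on LOW Hermite modes (Σ_n n²‖π_n u⁺‖² against the exact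
first-order budget γΣ_bΣ_n n‖π^b_n u‖² = ⟨u,J⟩); harmonic member: u quadratic, C = 2/γ; equivalent
up to constants to ‖A u⁻‖² ≲ γ²N·Z (even part of Lu = −J: A u⁻ = γΣ_b𝒩_b u⁺); if only ‖𝒩_b u⁺‖² ≲
N^{1+θ}Z, C′ needs order 3 + θ. #4′ BoundedResponseConverges
(crux, import slot, verbatim stmt-2741; live external supplier FourierGreenKubo.ThermodynamicLimit
stmt-0742; StaticAbelianSqueeze's
(R)+(S)+(G)+(P) also deliver it). #9 WitnessGlue (crux, rank-9 slot; rev 17 body, restated in place)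
— the TRANSPORT-WITNESS THEOREM
TapLeakBound → ConeScaleCorrector → SubBallisticWindow → BoundedResponse: the aligned Cauchy–Schwarz
pairing of u⁻ with the
closed chain's cone-windowed transport W (bookkeeping: quantised windows τ_i = 2^{⌊log₂(a d_i/2)⌋}
with a from P, dyadic time shells of the central
blocks B_m = {i : τ_i ≥ 2^m} reduced to E2 by Φ- and Θ-invariance of μ_T; leak: ⟨u⁻, j_i∘Φ_t⟩ − ⟨u⁻,
j_i⟩ = −γT∫₀^tΣ_b⟨∂_b u⁺, ∂_b(j_i∘Φ_s)⟩ds (CorrectorTheory (7)),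
|Σ_iτ_i∫₀^{τ_i}leak_i| ≤ γ·2C·Z√(1 + (N−1)T²D_N)·(a/2)²Σ_i d_i²(1 + d_i/2)^{−3/2} ≲ Z N²√D_N by P at
both contacts (s ≤ τ_i ≤ a d_i/2 ≤ a d′),
so 2T²D_N Σ_iτ_i ≤ ‖u⁻‖‖W‖/Z + O(N²√D_N) and D_N ≤ A + B√D_N; 0 ≤ D_N, finitely many small N
trivially) OVER the fixed-N lemma CorrectorTheory, which is
its LEMMA, not its hypothesis (rev 5–10: support form with CorrectorTheory etc. as hypotheses of
`closes`; rev 11–16: E3-based crux form, retired with E3). #9 NessUnique ✓ (crux since rev 11,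
shared by 60+ routes; PROVED, NessUnique_holds ← Theorems/EmbeddedDrudeMourreNessUnique): weak-FP
steady state ⇒ P_t-invariant ⇒ unique (CEHR2018 Thm 2.13).
#9 FiniteResponseOfUnique (crux since rev 11, shared by ~45 routes; reductions landed in
Theorems/EmbeddedDrudeMourreFiniteResponseOfUnique.lean incl. ResponseDensity ⇒
FiniteResponseOfUnique): existence of D_N.
SUPPORTS: ClosedConeSensitivity (E3, the rev-4 TANGENT cone; crux at rev 4–16, since rev 17 a HELD
settled-negative edge: MISSTATED.md, Disproof.lean,
Negative lane ZeroFrictionDictionary p80812 / TangentReduction p82694 — item 14059 re-attached as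
support with the decl verbatim because those files unfold it and are
opened by OddSectorIrreversibilityCorrectorTheory.lean / …SubBallisticWindowCoboundaryCeiling.lean;
NOT to be staffed; successor P = TapLeakBound ⇐ C′ + H1);
CorrectorTheory (fixed N, L) = CorrectorCalculus (existence / C¹ / L²-limit of u, bond sum rule, tap
energy
identity γT Σ_b‖∂_{p_b}u‖² = ⟨u, J⟩, leak identity ⟨u⁻, j_i∘Φ_t⟩ − ⟨u⁻, j_i⟩ = −γT∫₀^t Σ_b⟨∂_b u⁺,
∂_b(j_i∘Φ_s)⟩ds — THE FIRST
CHECKABLE STATEMENT; CEHR2018 regularity + KDN (reln2)–(reln3)) ∧ the open-chain Green–Kubo identity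
(= StaticAbelianSqueeze.
KuboAbelIdentity stmt-13419 VERBATIM as the second conjunct, M — one item because of the 15-item
cap) — since rev 11 a LEMMA beneath WitnessGlue and E1 (six helper files landed:
Theorems/OddSectorIrreversibilityCorrectorTheory{Existence,Smooth,Energy,SiteEnergy,DetFlow,WeakDynkin}.lean),
never a hypothesis of
`closes`; GibbsSteadyState (PROVED), BoundedResponse (shared, unchanged; the consequent of
WitnessGlue, bridged to the LocalOhmBV /
MatthiessenLadder copies by Iff.rfl); ResponseDensity, OddDensityIsCorrector (fixed-N dictionary
NESS ↔
corrector; they carry the corrected namesake and are hypotheses of the landed Negative file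
EchoFloor for 9140); OddCorrectorDecay (9139) and OddResponseBound (9140) DEMOTED to support =
settled-negative edges,
NOT to be staffed positively (9139 is held by the gate; 9140: Disproof §3 + numerics, EchoFloor
p73549 pending) and kept in the file
because Theorems/OddCorrectorDecay/Negative/FalseOfLocality.lean and the 9140 Negative lane name the
decls. Dropped: EngineGlue
(its Minkowski step is what the negative lemma kills), OddSufficiency (a valid one-liner whose input
SI is dead), and — for the
15-item cap only, both true and harmless — CurrentVarianceLinear (E1 is now stated against N²·Z
directly) and ReversalKLSecondOrder
(the KL ↔ L² dictionary stays in the prose; not referenced by any Theorems file); OddCorrectorDecay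
(rev 16, after ¬OddCorrectorDecay landed). Assembly restated to the
rev-17 chain (= the type of `closes`).
TWO-LAYER PLAN. Foreseen glued splits (nothing filed now; k ≤ 3, depth 1): E1 ⇐ PostCrossingForecast
(CrossingScrambling made
precise: ∃ a > 0 ∀ N u, ‖u − u_{aN}‖²_{L²(μ_T)} ≤ C·N²·Z — the forecast of the transport still to
come after ONE crossing is O(N) in
norm; the genuinely ergodic child) + ConeTransportBudget (‖u_τ‖² ≤ C·N·(1+τ)·Z ∀ τ ≥ 0,
Einstein–Helfand envelope of the open forecast
— E2's open twin by conditional Jensen) + glue ‖u‖ ≤ ‖u_{aN}‖ + ‖u − u_{aN}‖ (one-line item-ready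
Props + composition
coneScaleCorrector_of_items PROVED: evidence SketchE1Children.lean on stmt-14069 — ready for `route
edit --split ConeScaleCorrector`); E2 ⇐ space-time summability of closed-chain current covariances
uniformly in N (the
honest 'finite Green–Kubo second moment') + positivity bookkeeping; P ⇐ H1 + C′ (glue: fixed-N
Gaussian IBP with resampling projection + Cauchy–Schwarz; children TYPED — planner Sketch.lean
ResampledKickCone / BoundaryHermiteRegularity / SplitGlue, lean check rc 0 — and written to
children.json on the item, ready for `route edit --split TapLeakBound`); below them
(lemmas, not items): C′ ⇐ LinePerc of supersonic-hot-chain-ldp (SketchIdeator5.lean):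
ColdStretchDyson (deterministic two-copy secant comparison on K-cold stretches, both
copies capped; provable, constant 5/3-inflated per TRIAGE-r2-2 (S2)) + ClosedFlowLiouville +
GibbsLocalTail + Rice/upcrossing pricing (StationaryUpcrossingBound, audited sound
r1-2 App. B) + SHC (supersonic hot-chain decorrelation; exposure: carrier range law R_ss(K′) at T/K′
→ 0) + RLT₃ (receiver lifetime tail at order 3; exposure: Arrhenius
slope α of multi-site chaotic clusters), ≤ 7 stubs; the provable FLOOR LineP of
stationary-exceedance-cold-cone (window c·d/(log(2+d))^{1/4}, tail (2+d)^{−m} ∀m) is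
every lemma of it minus SHC/RLT; H1 ⇐ Hermite expansion in p_b + fixed-N hypoelliptic regularity +
one N-uniform bound on ‖A u⁻‖ or on Σ_n n²‖π_n u⁺‖² (corrector side,
card gaussian-ibp-resampled-kick). BRC's children live in FourierGreenKubo /
StaticAbelianSqueeze. WitnessGlue ⇐ CorrectorTheory (support lemma, fixed N) + the leak estimate (P,
integrated over the quantised windows) + the
dyadic-shell norm bound of W (E2) — lemmas via `--supports`, not items. The corrected namesake WSI
(sup_N ∫(h−hΘ)²dπ < ∞, one line from E1 + OddDensityIsCorrector) is left untyped to respect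
the item budget.
KILL CRITERIA. (a′) ¬E1 at true scale — numerically B_full(τ→∞)/N² = ‖u_N‖²/N² growing with N (the
crux idea's kit jobs
j008184 / j008186 print exactly this; harmonic control ∝ N; independent replica runs by the promote
seat at the DIFFUSIVE point
(1,1,0.1,1), T = 8, where the asymptotics is reachable at N ≤ 64 — kit j010940 (N = 8/16/32, M =
8000), j010941 (N = 48/64),
j010942 ((1,1,1,1), T = 8), script e1_replica_mc.py, summaries auto-attach to stmt-14069; reading
guide: B_full(τ)/N² must plateau in τ
at an N-independent value (E1), Vmid_closed/(|B|τ) stay flat in τ ≤ N and in N (E2), the replica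
overlap A_N(t) = ‖P_tJ‖²/‖J‖² halve at
t ∝ N and the bond-resolved overlap front advance linearly, slope v_B = 1/a (E3)); STATUS
2026-08-16: (a′) NOT triggered — at (1,1,0.1,1), T = 8 the plateau B_full/N² is FLAT, 52 ± 5 for
N = 32…256 (standing disprover, Cruxes/ConeScaleCorrector/Disproof.lean §6, kit j011342–j011345,
slope 1.95) and 23.1/44.3/55.2 (±2.6/3.8/4.5)
= 65.8·(1 − 5.2/N) for N = 8/16/32 (promote seat, kit j010940: true scale N² with a 1/N boundary
layer; pre-registered prediction 58.7/60.4
for the running j010941 at N = 48/64 against 83/110 under linear growth); at the hot point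
(1,1,1,1), T = 10 the plateau is N-independent
(850 ± 136 / 924 ± 104 / 790 ± 164 at N = 128/256/512, Disproof §6) and the harmonic control shows
slope 2.98 (∝ N, as it must), or a proof that the corrector keeps memory for ≫ 1 crossings — closes
the route refuted:ConeScaleCorrector (no cheaper aligned engine is known) and files the barrier 'a
deterministic bulk between two
taps never scrambles in O(1) crossings'. (b′) ¬E2: a ballistic channel in the equilibrium current
fluctuations of the CLOSED
anharmonic pinned chain (V(τ)/((k₂−k₁)τ) growing) — sinks FourierGreenKubo and the conjunct's
finiteness alike: file ¬FouriersLaw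
evidence. (c′) [rev 17] ¬P at order 3/2 but true at a smaller order, or C′ true only on the window
d/(log d)^{1/4}: the witness then gives D_N = O(N^θ) resp.
O((log N)^{1/4}) — honest partial (HasBoundedResponse missed), restate P / the glue to that form or
re-rank; ¬P at EVERY order on linear windows (a
positive-density class of receivers with lifetimes ≍ d, and no cancellation in the pairing) kills
the transport-witness pairing at this node — close
refuted:TapLeakBound unless a different leak control is found; ¬H1 alone (‖𝒩_b u⁺‖² ≳ N^{1+θ}Z) only
re-prices C′ at order 3 + θ inside the split. The typed
E3's own fate (TangentRayBlowup / EndTubeAmplifier″ constructible ⇒ ¬E3 lands) changes nothing: it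
is a held support edge since rev 17, repair = none. (d) ¬NessUnique kills clause (i) of the
conjunct itself. (e) BoundedResponse proved elsewhere (StaticAbelianSqueeze, FourierGreenKubo) moots
E1–E3 as a route but not the
corrected litmus; BRC refuted (D_N bounded but oscillating) breaks every bounded-response line at
once — a Cesàro form of clause (ii)
is then a new route. (f) The formal landing of ¬OddResponseBound or of ¬ClosedConeSensitivity flips
the route
BROKEN only nominally: the repair is `route edit --drop <the refuted edge> --note "settled negative
edge; not a hypothesis of closes
since rev 4"` — nothing else changes.
NOT DECOMPOSED YET. The children above; WSI as a typed item; the T-dependence of the constants (C₁ ≍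
σ²/(v_B⟨j²⟩), C₂ ≈ 2σ²,
a ≈ 1/v_B, κ — all blow up in the cold / harmonic corner, LowTemperatureWeakAnharmonicity;
admissible pointwise in T); the SPLIT of P into
H1 + C′ (typed; to be filed by the tenure planner or this seat's successor — `--split` is gated to a
final cycle); the provable FLOOR of C′ (LogWindowKickCone /
LogWindowResampledCone, SketchIdeator3g2.lean: window c·d/(log(2+d))^{1/4} after supersonic
consequence (ii), tail (2+d)^{−m} ∀m, gives D_N = O((log N)^{1/4}) — not an
item: it does not reach FouriersLaw); the order ladder of C′ against H1 (‖𝒩_b u⁺‖² ≲ N^{1+θ}Z ⇔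
order 3 + θ); GaussianIBPProjection′ and 'corrector ∈ C²' as fixed-N
`--supports` lemmas; OPEN-kernel variants of E2 / C′; a re-badge of the held E3 and a re-rank once
the gate's retriage path works again on this route; barrier
candidates for the catalogue: NoUniformNormDecayUnderBoundaryNoise (9139 disproof: no extensive
observable of a boundary-driven deterministic chain has N-uniformly
integrable L²(μ)-NORM decay), TubeAmplifier BN1 (TRIAGE-r2-3 §C(3): no d-uniform annealed
L^q(Gibbs), q ≥ 2, DERIVATIVE / Poisson-bracket cone on linear rays for the
closed or boundary-driven quartic chain once H∞(ρ) carries a hyperbolic localised periodic orbit at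
the contact — derivative cones only; capped / resampled differences
keep an exponential shadowing tail), ReceiverBreatherTail B4, PersistentHotSpotGronwall B1
(ideator-3 notes).
CHEAPEST FALSIFIER. (1) Exact Gaussian algebra, an afternoon (scripts already on item 9139:
harmonic_witness.py, kit j009076):
harmonic open chain — the witness inequality must be an identity up to O(1) factors with exponents
‖u‖² ≍ N³, ‖W‖² ≍ N³(log),
D_N ≍ N (tight), the bond sum rule exact, E3 true with a < 1/v_sound; velocity-flip chain
(stochastic bulk, Fourier proved): E1
holds in the STRONGER form ‖u‖² ≍ N and the inequality returns D_N → κ(λ) within a constant — a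
drifting constant kills the glue's
bookkeeping. (2) Replica Monte Carlo already queued by the crux idea's author (kit j008184 N ≤ 64,
j008186 N = 128; script
cone_witness.py on item 9139): B_full(end)/N² → const (E1), V_closed(τ)/(2τN) flat in τ ≤ N and N
(E2), alignment
cos∠(u⁻_τ, W) ≈ 1 up to τ ≈ N/(2v_B); any one failing kills its crux before a prover touches it; the
promote seat's j010940–j010942 (above) repeat (2) where the
refuter's caveat does not bite ((1,1,1,1), T = 1 is quasi-ballistic up to N ≳ 64: ‖u⁻‖² ∝ N³
pre-asymptotically there). (3) P / C′ / H1 [rev 17; one batched kit job each, BEFORE a crux-plan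
seat is spent — TRIAGE-r2-1 §C(4), r2-3 §C(4)]: (i) lifetime law τ̄(E) of
rate-UNBOUNDED multi-site chaotic clusters in a THERMAL background at ρ = 0.1 and ρ ≤ 0.03 — an
Arrhenius slope α ≥ 1/3 kills order 3 (single-site objects:
α ≈ 0.08–0.09 at ρ = 0.1, T = 1–2, kit j014874/j015061, but their rate is bounded ≈ 0.13 and they
are excluded); (ii) supersonic range law R_ss(K′) beyond
K′/T = 160 (SHC's product form; zero-T pulses are lossless, j014907); (iii) H1: Hermite spectrum of
u⁺ in p_0 from the replica estimator of E1's kit jobs —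
Σ_n n²‖π_n u⁺‖²/(N·Z) must plateau in N; harmonic control = 2/γ exactly; (iv) P directly: the leak
rate T⟨∂_{p_0}u⁺, ∂_{p_0}(j_d∘Φ_s)⟩ is an equilibrium
expectation — replica forecast for ∂_{p_0}u⁺ (pathwise derivative of the noise-averaged transport,
common random numbers) paired with the closed-chain tangent
entry: (1 + d − s/a)^{3/2}·|pairing|/(Z√(N D_N)) must stay bounded along rays s = θad at N = 32–128,
while the NORM of the tangent entry blows up.
NUMBERS. TRUE-SCALE MEASUREMENTS OF THE NEW CRUXES (2026-08-16; evidence on stmt-14069: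
j010940-READING.md + stdout, Disproof.lean §6):
(1,1,0.1,1), T = 8, replica MC from Gibbs samples — E1: B_full(τ)/N² = ‖u_τ‖²_π/N² saturates at τ ≈
N (the cone time) to 23.1 / 44.3 / 55.2
(N = 8/16/32, M = 8000) and 52 ± 5 flat for N = 32…256, i.e. ‖u_N‖²_π ≈ 66·N²·(1 − 5.2/N), C₁(T = 8)
≈ 66 ≈ 4.7·⟨J²⟩/(N−1) (⟨J²⟩/(N−1) =
13.9/12.6/12.1, ⟨j_i²⟩ ≈ 19); desynchronisation: replica current overlap A_N(t) = ‖P_tJ‖²/‖J‖²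
halves at t_½ ≈ 4 / 9 / 18.5 ≈ 0.55·N and the
bond-resolved overlap fronts advance at 0.50 bonds per unit time from each contact for every N (v_B
≈ 0.5, a ≈ 2; B_full saturates exactly
when the fronts meet); E2: V_mid(τ)/(|B|τ) for the central block of the CLOSED chain rises over the
correlation time (20.7 → 38 → 60 → 77 at
τ = 2/4/8/16, N = 32), levels at ≈ 82 (τ = 24–32) and then decays by finite-size saturation — no
superlinear growth in τ; block-size
maxima 46 / 62 / 82 for |B| = 4/8/16 (the Einstein–Helfand plateau 2σ² is approached from below);
open-chain V_open/(Nτ) ≈ 98–101 at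
N = 32, τ ≥ 48 (bath exchange); current autocorrelation C_N(t)/C_N(0) = 0.72/0.48/0.17/0.00 at t =
2/4/8/16 (correlation time ≈ 2–3 ≪ cone
time). Earlier measurements (evidence on items 9139 / 9140): memory half-life of ‖P_tJ‖²: t_½ = 3.5
/ 8.0 / 16.0 / 23.25 for N = 8/16/32/48
≈ N/2 (fronts at ≈ 0.5 bond per unit time; v_B ≈ 0.40 at (1,1,1,1), T = 1, harmonic 0.38); a_N =
N∫(h−hΘ)² = 25 / 100 / 375
(N = 8/16/32, T = 1; S = 2000 samples) and 0.14 / 0.40 / 0.75 at (1,1,0.1,1), T = 8; harmonic a_N =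
0.30N²; stochastic bulk
a_N → 0.19 (flip rate 1), BLL N·I_N → 0.78. Scales the cruxes are measured against: ‖J‖²/Z ≈ 0.19·N
(harmonic) – 0.41·N
(anharmonic, T = 1); E1 true scale ‖u‖²/Z ≈ σ²N·N/(2v_B); Σ_N ≥ aN²/32 after quantisation; harmonic
exponents (3, 3, 1) for
(‖u‖², ‖W‖², D_N) make the witness inequality TIGHT at the integrable point; KDN normalisation D_N =
⟨J, u⟩_π/((N−1)T²). E3 → P numerics (evidence on stmt-14059, kit
j010948/j012710/j012754/j014142/j014146/j012934):
typed-E3 tangent mean square M2 on rays is carried by the top 1 % of samples (82–97 %; mean/median =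
516…2270 at the far end, N = 128, S = 4000); the fixed-kick mean
square F2_1 SATURATES at 0.4–1.2 on every ray while F2_{0.01}/10⁻⁴ tracks M2 up to 10²–10³ (the cap
works; C′'s object is the saturating one); planted clusters:
λ(e) ≈ 0.05·e^{1/4} (λ_q90/E^{1/4} = 0.042/0.049/0.053/0.058 at E = 16…1024), energy retention
plateaus R = 0.38/0.21/0.15/0.10/0.10 for e = 4…64 (self-trapping);
harmonic control mean/median ≡ 2.2 with a clean linear cone; Rice/upcrossing bound check passed at
20/20 (E, τ) pairs. Items after
rev 5: 15 = 4 cruxes (E1, E2, E3, BRC) + 8 supports (CorrectorTheory, WitnessGlue, NessUnique,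
GibbsSteadyState,
FiniteResponseOfUnique, BoundedResponse, ResponseDensity, OddDensityIsCorrector) + 2
settled-negative edges + 1 assembly. Items after
rev 11: 15 = 7 cruxes (E1, E2, E3, BRC, WitnessGlue, NessUnique, FiniteResponseOfUnique) + 5
supports (CorrectorTheory,
GibbsSteadyState, BoundedResponse, ResponseDensity, OddDensityIsCorrector) + 2 settled-negative
edges + 1 assembly; `closes` assumes the
7 cruxes and nothing else. Items after rev 17: 15 top-level = 7 cruxes (E1, E2, P = TapLeakBound,
BRC, WitnessGlue, NessUnique ✓, FiniteResponseOfUnique) + 5 supports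
(CorrectorTheory, GibbsSteadyState ✓, BoundedResponse, ResponseDensity, OddDensityIsCorrector) + 2
settled-negative edges (ClosedConeSensitivity held, OddResponseBound) + 1
assembly; `closes` assumes the 7 cruxes and nothing else; second layer to be filed: H1, C′ under P.
DEFINITION REQUESTS. None. The closed flow is `(pinnedChain ω₂ lam β 0).transitionKernel N T T t`
(zero friction ⇒ zero noise;
pinnedChain_transitionKernel_apply holds for γ ≥ 0), kicks are `(x.1, Function.update x.2 b (x.2 b +
s))`, partial derivatives are the
tree's `partialP`, the corrector is characterised inline exactly as in OddDensityIsCorrector, the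
Green–Kubo conjunct uses `gibbsMeasure`
(import Literature.MathematicalPhysics.KineticTheory.LangevinChainGibbs added). All five new decls
elaborate (planner Sketch.lean /
GlueCheck.lean, lean check rc 0) and `closes` is re-proved over them (standard axioms). Rev 17:
still no definition request — P uses the tree's `partialP`, the even
part `(u x + u (x.1, −x.2))/2` and the closed-flow kernels; the children use Mathlib's
`ProbabilityTheory.gaussianReal 0 T.toNNReal` for the resampling law, the resampled
copy `(x.1, Function.update x.2 b p′)` and the Ornstein–Uhlenbeck tap operator written with
`partialP` as `−(T·∂_b(∂_b f)) + p_b·∂_b f`; P, H1, C′, the restated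
WitnessGlue and `closes` elaborate together against the live route file (planner Sketch.lean, lean
check rc 0, 0 sorry, axioms propext/Classical.choice/Quot.sound). A
shared `Theorems/OddSectorIrreversibilityDefs.lean` (bathOp / resample / resampleVar as in
Cruxes/ClosedConeSensitivity/Restatement.lean) may be landed by any prover and
bridged to the inline forms by `rfl`.

Novelty: Searches RUN this session (route-choice seat, 2026-08-16, on top of the plancard / retriage searches
recorded for rev 1–3, which stand
for the unchanged supports): `ledger negatives --problem AtomisticToContinuum` (12 refuted
statements; FouriersLaw: far-field
Gaussianity only — nothing on corrector / Green–Kubo / cone objects); all 78 Theses files of the sub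
grepped for resolvent / corrector /
windowed-GK cruxes (found: StaticAbelianSqueeze.ResolventSqueeze + UniformAbelianRegularity —
resolvent at ν > 0 with infinite-chain
variational statics; FourierGreenKubo — L¹ tail + κ = κ_GK; PhononMeanFreePath.BoundaryKubo — a
fixed-N identity; BoundaryEscapeDeficit /
GriffithsLimitExchange — exit laws; HonestZwanzig — Feshbach memory kernel; none pairs the open
corrector with a closed-chain witness);
the crux dossiers read in full: Cruxes/OddCorrectorDecay/{Disproof.lean, NOTES.md, Ideas/× 4},
Cruxes/OddResponseBound/{Disproof.lean,
TRIAGE-r1-1, Ideas/× 2}, Theorems/OddCorrectorDecay/Negative/FalseOfLocality.lean,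
Literature/…/OddSectorLocalityHypothesis.lean, the
evidence lists of items 9139 / 9140 (twin-history numerics j008646, exact Gaussian checks j007912 /
j009076); bib keys verified with
`ledger bib get`; lit galaxy / frontier NOT re-run (repair seat, no new literature claim beyond the
cited items). Literature drawn on:
KunduDharNarayan2009 pp. 2–3 (open-chain Green–Kubo, (reln2)–(reln3); the t_c ∼ L cut-off "has no
rigorous justification"),
doi:10.1016/S0370-1573(02)00558-6  [refs: 10.1016/S0370-1573(02, 10.1007/s10955-007-9278-0, 1711.07505, 1911.03753, 2002.05629, 1103.2835, 0809.4543, doi:10.1016/S0370-1573, doi:10.1007/s10955-007-9278-0, KunduDharNarayan2009, MaesNetocny2010, MarchioroPellegrinottiPulvirenti1978, ButtaMarchioro2016, BernardinOlla2005, BernardinOlla2011, KomorowskiLandimOlla2012, CuneoEckmannHairerReyBellet2018, BeckerMenegaki2022, DasEtAl2018, KumarEtAl2]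

Barriers (technique_class: resolvent-one-vector; windowed-green-kubo; causal-cone): - technique_class: resolvent-one-vector; windowed-green-kubo; causal-cone
- Literature.Barriers.AtomisticToContinuum.HasBoundedResponse: NOT evaded — E1 and E2 ARE
"information on the dependence of D on L"; the bet, stated plainly: they are the weakest such
information that is (i) at TRUE scale (the Cauchy–Schwarz is aligned, no slack is needed or
available), (ii) of two cleanly separated types neither of which is a NESS statement — an OPEN-chain
equilibrium resolvent bound on one explicit vector and a CLOSED-chain finite-window variance ceiling
— and (iii) each false at lam = β = 0 with the right exponent (N³, N³·log;
HarmonicChainBallisticFlux / not_hasBoundedResponse in tree).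
- Literature.Barriers.AtomisticToContinuum.BeckerMenegaki2022_gapClosing and
Literature.Barriers.AtomisticToContinuum.equilibrium_rate_bound: evaded — no rate, no gap, no
semigroup-norm decay anywhere; E1 bounds ‖L_N⁻¹J‖ for ONE odd vector, compatible with gaps closing
like N⁻³ or worse; the rev 1–3 engine that DID claim integrated norm decay is recorded dead by the
same mechanism these entries formalise (FalseOfLocality; barrier candidate
NoUniformNormDecayUnderBoundaryNoise: for boundary-driven chains with deterministic bulk no
extensive observable has N-uniformly integrable L²(μ)-norm decay, memory half-life ≥ cN/v —
technique class hit: parity-sector-semigroup-decay, any "Minkowski then decay" engine).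
- Literature.Barriers.AtomisticToContinuum.Mazur1969_inequality (with MazurBoundBallisticOpenCh

History (route lifecycle, newest last):
- 2026-08-16T02:18:35Z · rev 5: dropped EngineGlue, OddSufficiency, ReversalKLSecondOrder, CurrentVarianceLinear — route-choice pivot (rchoice seat 6dd2c330, 2026-08-16), step 2 of 3 (15-item cap + crux floor force a staged edit): add crux ClosedConeSensitivity (E3, rank 4: (planner-rchoice-AtomisticToContinuum-OddSector-6dd2c330-0)
- 2026-08-16T02:23:05Z · rev 6: restated Assembly (stmt-AtomisticToContinuum-14058) — route-choice pivot (rchoice seat 6dd2c330, 2026-08-16), step 3 of 3: add cruxes ConeScaleCorrector (E1, rank 2: ‖u_N‖²_{L²(μ_T)} ≤ C·N²·Z for the open Kubo corr (planner-rchoice-AtomisticToContinuum-OddSector-6dd2c330-0)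
- 2026-08-16T07:51:11Z · rev 11: restated WitnessGlue (stmt-AtomisticToContinuum-14072), Assembly (stmt-AtomisticToContinuum-14068 proved) — crux-only repair (rbadge seat 7b1690f9, 2026-08-16; needs_repair glue.non-crux-hypothesis: closes assumed WitnessGlue, CorrectorTheory, NessUnique, FiniteRespon (planner-rbadge-AtomisticToContinuum-OddSectorI-7b1690f9-0)
- 2026-08-16T08:51:40Z · BROKEN — OddCorrectorDecay (stmt-AtomisticToContinuum-9139, support) refuted by Summit.AtomisticToContinuum.FouriersLaw.Theorems.not_OddCorrectorDecay (prover-pitem-stmt-AtomisticToContinuum-9139-0)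
- 2026-08-16T09:03:08Z · rev 16: dropped OddCorrectorDecay — route-choice (rchoice seat 688c3237, 2026-08-16): NEXT LINE = the transport-witness line already in place since rev 4–11 (E1 ConeScaleCorrector / E2 SubBallisti (planner-rchoice-AtomisticToContinuum-OddSector-688c3237-0)
- 2026-08-16T09:03:08Z · REPAIRED (drop OddCorrectorDecay) — back to open: route-choice (rchoice seat 688c3237, 2026-08-16): NEXT LINE = the transport-witness line already in place since rev 4–11 (E1 ConeScaleCorrector / E2 SubBallisti (planner-rchoice-AtomisticToContinuum-OddSector-688c3237-0)
- 2026-08-16T09:41:16Z · rev 17: restated ClosedConeSensitivity (stmt-AtomisticToContinuum-14059), WitnessGlue (stmt-AtomisticToContinuum-15120), Assembly (stmt-AtomisticToContinuum-15095 proved) — route-choice (rchoice seat 4801cdfb, 2026-08-16) for crux stmt-14059 ClosedConeSensitivity (E3): RESTATED. The Negative lane p80812/p82694 makes th (planner-rchoice-AtomisticToContinuum-OddSector-4801cdfb-0)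
- 2026-08-26T10:15:17Z · DORMANT — reconciler: no traction for 8.4 d (last activity item-evidence-added at 2026-08-18T00:41:32Z); parked, not closed — `ledger route dormant route-AtomisticToConti (operator:999:3854548)

sub-problem: FouriersLaw · status: dormant · opened planner-plancard-AtomisticToContinuum-Fourier-0ef2f3d0-0 2026-08-15T13:51:04Z · rev 17 · ledger route-AtomisticToContinuum-OddSectorIrreversibility
GENERATED by the gate from the ledger (D-0016/17). Provers cite these decls: `theorem foo : Summit.AtomisticToContinuum.FouriersLaw.Theses.OddSectorIrreversibility.<Decl> := …` in Summits/AtomisticToContinuum/FouriersLaw/Theorems/<Name>.lean.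
-/

namespace Summit.AtomisticToContinuum.FouriersLaw.Theses.OddSectorIrreversibility

open scoped BigOperators Topology Manifold Classical MeasureTheory ProbabilityTheory Matrix InnerProductSpace ComplexConjugate ContinuousMap
open Filter Set Function TopologicalSpace MeasureTheory

attribute [summit_statement] _root_.FouriersLaw

/-- item stmt-AtomisticToContinuum-14069 · crux · rank 2 · open · by planner
why it might fail: Scrambling of a deterministic bulk by two boundary taps is unproved for any anharmonic chain: if the corrector keeps memory for ≫1 causal crossings (weak chaos, sticky breathers / KAM islands at low T·lam) ‖u_N‖² ≫ N² (≍N³ at lam=β=0); C ≍ σ²/v_B blows up in the cold/harmonic corner.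
sources: KunduDharNarayan2009, BonettoLebowitzReyBellet2000, BernardinOlla2005, BeckerMenegaki2022, CuneoEckmannHairerReyBellet2018, LepriLiviPoliti2003
[crux] (E1, rank 2 — the engine at TRUE scale; replaces the dead engine OddCorrectorDecay) for all
ω₂, lam, β, γ > 0 and T > 0 there is C(T) with, for every N and every a.e.-limit u of the
finite-horizon Kubo correctors u_τ = ∫₀^τ P_tJ_tot dt (equilibrium OPEN kernels transitionKernel N T
T; the corrector exists, is C¹ and is the L²-limit by CorrectorTheory — nothing is smuggled, the
predicate is verbatim that of OddDensityIsCorrector / CorrectorTheory): u ∈ L²(μ_T) and ∫u² dμ_T ≤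
C·N²·Z (μ_T = e^{−H_N/T}dqdp unnormalised, Z its mass; ‖J‖² ≍ N·Z, so this is the one-vector
resolvent bound ‖L⁻¹J‖ ≲ √N·‖J‖). Scale: u(x) = E[∫₀^∞ J_tot(X_t)dt | X_0 = x] carries the
deterministic bulk transport of the causal window t ≲ N/v_B (Var ≍ σ²N·N/(2v_B)); the claim is that
NOTHING MORE survives — boundary noise + bulk chaos scramble the microstate within O(1) causal
crossings. One Cauchy–Schwarz against J gives only D_N = O(√N); the aligned witness of WitnessGlue
gives D_N = O(1). Harmonic member: ‖u‖² ≍ N³ (fails as it must). Numerics pending: B_full(end)/N² of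
the crux idea's kit jobs j008184 / j008186. [deps: CorrectorTheory] [difficulty: open-problem] -/
@[route_item "route-AtomisticToContinuum-OddSectorIrreversibility", crux]
def ConeScaleCorrector : Prop :=
  ∀ ω₂ lam β γ : ℝ, 0 < ω₂ → 0 < lam → 0 < β → 0 < γ → ∀ T : ℝ, 0 < T → ∃ C : ℝ, ∀ (N : ℕ) (u : Literature.MathematicalPhysics.KineticTheory.HeatConduction.PhaseSpace N → ℝ), let P := Literature.MathematicalPhysics.KineticTheory.HeatConduction.pinnedChain ω₂ lam β γ; let μT : MeasureTheory.Measure (Literature.MathematicalPhysics.KineticTheory.HeatConduction.PhaseSpace N) := MeasureTheory.volume.withDensity (fun x : Literature.MathematicalPhysics.KineticTheory.HeatConduction.PhaseSpace N => ENNReal.ofReal (Real.exp (-(P.hamiltonian N x) / T))); let J : Literature.MathematicalPhysics.KineticTheory.HeatConduction.PhaseSpace N → ℝ := fun z => ∑ i : Fin N, P.bondCurrent N i z; (∀ᵐ x ∂μT, Filter.Tendsto (fun τ : ℝ => ∫ t in Set.Ioc (0 : ℝ) τ, (∫ y, J y ∂(P.transitionKernel N T T t.toNNReal x))) Filter.atTop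 (nhds (u x))) → MeasureTheory.MemLp u 2 μT ∧ ∫ x, (u x) ^ 2 ∂μT ≤ C * (N : ℝ) ^ 2 * ∫ x, Real.exp (-(P.hamiltonian N x) / T) ∂MeasureTheory.volume

/-- item stmt-AtomisticToContinuum-14070 · crux · rank 3 · open · by planner
why it might fail: N-uniform finite-window GK second moments are unproved for every deterministic anharmonic chain (BLR2000 §6.3): a ballistic fluctuation channel (harmonic: (k₂−k₁)²τ log τ) or superdiffusive spreading breaks C(1+τ)(k₂−k₁); pinning removes sound modes, which is the bet.
sources: LepriLiviPoliti2003, KunduDharNarayan2009, BonettoLebowitzReyBellet2000, Dhar2008, BernardinOlla2011, AokiLukkarinenSpohn2006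
[crux] (E2, rank 3) CLOSED chain (Φ_t = (pinnedChain ω₂ lam β 0).transitionKernel N T T t: zero
friction ⇒ zero noise, the deterministic Hamiltonian flow with the same H): ∃ C(T) ∀ N, blocks of
bonds [k₁,k₂) with k₂ ≤ N−1, τ ≥ 0: ∫ (∫₀^τ J_{[k₁,k₂)}(Φ_t x) dt)² dμ_T(x) ≤ C(1+τ)(k₂−k₁)·Z, Z =
∫e^{−H/T}: windowed block transport of the ISOLATED chain at equilibrium grows at most diffusively
(Einstein–Helfand, C ≈ 2σ² ≈ 4κ_GK T²), uniformly in N, block and window — a finite-window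
Green–Kubo VARIANCE CEILING (upper bound only: no κ = κ_GK, no L¹ tail, no infinite volume). Large τ
is harmless (j_i = d/dt E_{>i} along Φ, so the window integral is a bounded energy difference); the
content is the regime 1 ≪ τ ≲ N. WitnessGlue applies it to the central blocks B_m = {i : τ_i ≥ 2^m}
on dyadic time shells. Harmonic member: ≍ (k₂−k₁)²τ log τ (ballistic), fails as it must.
[difficulty: open-problem] -/
@[route_item "route-AtomisticToContinuum-OddSectorIrreversibility", crux]
def SubBallisticWindow : Prop :=
  ∀ ω₂ lam β γ : ℝ, 0 < ω₂ → 0 < lam → 0 < β → 0 < γ → ∀ T : ℝ, 0 < T → ∃ C : ℝ, ∀ (N k₁ k₂ : ℕ), k₁ ≤ k₂ → k₂ + 1 ≤ N → ∀ τ : ℝ, 0 ≤ τ → let P := Literature.MathematicalPhysics.KineticTheory.HeatConduction.pinnedChain ω₂ lam β γ; let P₀ := Literature.MathematicalPhysics.KineticTheory.HeatConduction.pinnedChain ω₂ lam β 0; let μT : MeasureTheory.Measure (Literature.MathematicalPhysics.KineticTheory.HeatConduction.PhaseSpace N) := MeasureTheory.volume.withDensity (fun x : Literature.MathematicalPhysics.KineticTheory.HeatConduction.PhaseSpace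 N => ENNReal.ofReal (Real.exp (-(P.hamiltonian N x) / T))); let JB : Literature.MathematicalPhysics.KineticTheory.HeatConduction.PhaseSpace N → ℝ := fun z => ∑ i : Fin N, (if k₁ ≤ i.val ∧ i.val < k₂ then P.bondCurrent N i z else 0); ∫ x, (∫ t in Set.Ioc (0 : ℝ) τ, (∫ y, JB y ∂(P₀.transitionKernel N T T t.toNNReal x))) ^ 2 ∂μT ≤ C * (1 + τ) * ((k₂ : ℝ) - k₁) * ∫ x, Real.exp (-(P.hamiltonian N x) / T) ∂MeasureTheory.volume

/-- item stmt-AtomisticToContinuum-15159 · crux · rank 4 · open · by planner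
why it might fail: Pairs ∂_b u⁺ with the amplifier-exposed tangent entry ∂_b(j_i∘Φ_s), N-uniformly: the p_b-smoothness of the noise-averaged corrector must absorb rare tangent blow-ups (IBP split: H1 2nd-derivative Hermite regularity × C′ receiver lifetimes, α ≥ 1/3 kills order 3); order 3/2 is the glue's minimum.
sources: ButtaMarchioro2016, ButtaEtAl2007, MarchioroEtAl1978, RazSims2009, KootVanDeVen2025, KumarEtAl2020
[crux] (P, rank 4; REV-17 SUCCESSOR of the held / misstated E3 `ClosedConeSensitivity` in its crux
slot — restatement menu Cruxes/ClosedConeSensitivity/MISSTATED.md §4, Disproof.lean §4 (R2),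
Restatement.lean; filed as ONE top-level crux = the leak budget `WitnessGlue` actually consumes,
because the 15 top-level slots are full) TAP-LEAK BUDGET of the transport-witness pairing: ∃ a, C >
0 ∀ N, bond i, contact b ∈ {0, N−1} (d = i for b = 0, d = N−2−i for b = N−1), every u ∈ C¹ ∩ L²(μ_T)
that is the μ_T-a.e. limit of the finite-horizon Kubo correctors ∫₀^τ P_tJ_tot dt (i.e. u = u_N, L u
= −J_tot, equilibrium OPEN kernels), s ∈ [0, a·d]: |T ∫ ∂_{p_b}u⁺ · ∂_{p_b}(j_i∘Φ_s) dμ_T| ≤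
C·√((|∫u·J_tot dμ_T| + Z)·Z)·(1 + (d − s/a))^{−3/2} [= C·Z·√(1 + (N−1)T²|D_N|)·(1 + d − s/a)^{−3/2}
under the Green–Kubo conjunct of CorrectorTheory], u⁺ = (u + u∘Θ)/2, Φ_s = zero-friction kernels
(Dirac at the closed Hamiltonian flow, ZeroFrictionDictionary p80812), ∂ = the tree's partialP. This
is the N-uniform input of the leak identity CorrectorTheory (7): ⟨u⁻, j_i∘Φ_t⟩ − ⟨u⁻, j_i⟩ =
−γT∫₀^tΣ_b⟨∂_b u⁺, ∂_b(j_i∘Φ_s)⟩ds. A PAIRING, not a norm: the tangent entry ∂_{p_b}(j_i∘Φ_s) —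
whose L²(Gibbs) norm on linea -/
@[route_item "route-AtomisticToContinuum-OddSectorIrreversibility", crux]
def TapLeakBound : Prop :=
  ∀ ω₂ lam β γ : ℝ, 0 < ω₂ → 0 < lam → 0 < β → 0 < γ → ∀ T : ℝ, 0 < T → ∃ a C : ℝ, 0 < a ∧ ∀ (N : ℕ) (i b : Fin N) (u : Literature.MathematicalPhysics.KineticTheory.HeatConduction.PhaseSpace N → ℝ) (s : ℝ), (b.val = 0 ∨ b.val = N - 1) → 0 ≤ s → let P := Literature.MathematicalPhysics.KineticTheory.HeatConduction.pinnedChain ω₂ lam β γ; let P₀ := Literature.MathematicalPhysics.KineticTheory.HeatConduction.pinnedChain ω₂ lam β 0; let μT : MeasureTheory.Measure (Literature.MathematicalPhysics.KineticTheory.HeatConduction.PhaseSpace N) := MeasureTheory.volume.withDensity (fun x : Literature.MathematicalPhysics.KineticTheory.HeatConduction.PhaseSpace N => ENNReal.ofReal (Real.exp (-(P.hamiltonian N x) / T))); let J : Literature.MathematicalPhysics.KineticTheory.HeatConduction.PhaseSpace N → ℝ := fun z => ∑ k : Fin N, P.bondCurrent N k z; let ue : Literature.MathematicalPhysics.KineticTheory.HeatConduction.PhaseSpace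 N → ℝ := fun x => (u x + u (x.1, -x.2)) / 2; let js : Literature.MathematicalPhysics.KineticTheory.HeatConduction.PhaseSpace N → ℝ := fun x => ∫ y, P.bondCurrent N i y ∂(P₀.transitionKernel N T T s.toNNReal x); let d : ℕ := (if b.val = 0 then i.val else N - 2 - i.val); ContDiff ℝ 1 u → MeasureTheory.MemLp u 2 μT → (∀ᵐ x ∂μT, Filter.Tendsto (fun τ : ℝ => ∫ t in Set.Ioc (0 : ℝ) τ, (∫ y, J y ∂(P.transitionKernel N T T t.toNNReal x))) Filter.atTop (nhds (u x))) → s ≤ a * (d : ℝ) → |T * ∫ x, Literature.MathematicalPhysics.KineticTheory.HeatConduction.partialP b ue x * Literature.MathematicalPhysics.KineticTheory.HeatConduction.partialP b js x ∂μT| ≤ C * Real.sqrt ((|∫ x, u x * J x ∂μT| + ∫ x, Real.exp (-(P.hamiltonian N x) / T) ∂MeasureTheory.volume) * ∫ x, Real.exp (-(P.hamiltonian N x) / T) ∂MeasureTheory.volume) / (1 + ((d : ℝ) - s / a)) ^ (3 / 2 : ℝ)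

/-- item stmt-AtomisticToContinuum-9141 · crux · rank 4 · open · by planner
why it might fail: Half of Fourier's law itself: D_N may stay bounded yet oscillate in N (no monotonicity/subadditivity in the length is known; size resonances at low T, mean free path ≍(lam T)⁻² > N) or tend to 0 (no N-uniform lower bound on the conductance beyond μ(Φ) > 0 at fixed N; BLR2000 §6.3, EPR1999b).
sources: BonettoLebowitzReyBellet2000, EckmannPilletReyBellet1999b, doi:10.1016/S0370-1573(02)00558-6, arXiv:cond-mat/0112193, AokiLukkarinenSpohn2006, BricmontKupiainen2007
[crux] IMPORT SLOT (verbatim stmt-AtomisticToContinuum-2741 of route LocalOhmRigidity; dedup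
attaches this route): under uniqueness, along any steady-state family and T > 0, if the response
coefficients D_N of clause (ii) exist and (|D_N|) is bounded then D_N → k for some k > 0.
'FouriersLawFor minus HasBoundedResponse'; expected from FeketeResistance
(QuasiSubadditiveResistance + PositiveConductance + FeketeGlue) or FourierGreenKubo's
ThermodynamicLimit — NOT this route's mechanism, declared residual once HasBoundedResponse is in
hand. [difficulty: L] -/
@[route_item "route-AtomisticToContinuum-OddSectorIrreversibility", crux]
def BoundedResponseConverges : Prop :=
  ∀ ω₂ lam β γ : ℝ, 0 < ω₂ → 0 < lam → 0 < β → 0 < γ → (∀ (N : ℕ) (T_L T_R : ℝ), 0 < T_L → 0 < T_R → ∀ μ ν : MeasureTheory.Measure (Literature.MathematicalPhysics.KineticTheory.HeatConduction.PhaseSpace N), (Literature.MathematicalPhysics.KineticTheory.HeatConduction.pinnedChain ω₂ lam β γ).IsSteadyState N T_L T_R μ → (Literature.MathematicalPhysics.KineticTheory.HeatConduction.pinnedChain ω₂ lam β γ).IsSteadyState N T_L T_R ν → μ = ν) → ∀ μ : (N : ℕ) → ℝ → ℝ → MeasureTheory.Measure (Literature.MathematicalPhysics.KineticTheory.HeatConduction.PhaseSpace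 N), (∀ (N : ℕ) (T_L T_R : ℝ), 0 < T_L → 0 < T_R → (Literature.MathematicalPhysics.KineticTheory.HeatConduction.pinnedChain ω₂ lam β γ).IsSteadyState N T_L T_R (μ N T_L T_R)) → ∀ T : ℝ, 0 < T → ∀ D : ℕ → ℝ, (∀ N : ℕ, Filter.Tendsto (fun δ : ℝ => (Literature.MathematicalPhysics.KineticTheory.HeatConduction.pinnedChain ω₂ lam β γ).totalCurrent (μ N (T + δ / 2) (T - δ / 2)) / δ) (nhdsWithin 0 {(0 : ℝ)}ᶜ) (nhds (D N))) → BddAbove (Set.range fun N => |D N|) → ∃ k : ℝ, 0 < k ∧ Filter.Tendsto D Filter.atTop (nhds k)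

/-- item stmt-AtomisticToContinuum-0717 · crux · rank 9 · closed · proved by Summit.AtomisticToContinuum.FouriersLaw.Theorems.FourierGreenKubo.finiteResponseOfUnique_holds (prover) · by planner
why it might fail: Differentiability at δ=0 of δ ↦ μ_{N,T+δ/2,T−δ/2}(j_i) is NOT in print for Langevin baths: ReyBellet2003 Rem 4.4 states finite-volume Green–Kubo unproved, HairerMajda2009 Thm 4.4 Assumption 5 fails here (only the e^{θH} framework of Thm 2.3); Lipschitz-only dependence leaves D_N undefined.
sources: ReyBellet2003, HairerMajda2009, CuneoEckmannHairerReyBellet2018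
CONDITIONAL FORM OF 0705 (supersedes it as the prover target; refuters pool-5/g3-0: 0705 stand-alone
quantifies over EVERY steady-state family and is false-prone if weak steady states were non-unique):
assuming UNIQUENESS of weak steady states (IsSteadyState class) for pinnedChain at all N, T_L, T_R >
0, the finite-N linear-response limit D_N(T) = lim_{δ→0, δ≠0} totalCurrent(μ_{N,T+δ/2,T−δ/2})/δ
exists for every T > 0 and N. Content: differentiability at equilibrium of NESS expectations of the
polynomial currents in the bath temperatures (ReyBellet2003 arXiv:math-ph/0303021 Rem 4.4 (51)–(56)
finite-volume Green–Kubo; HairerMajda2009 arXiv:0909.4313 Thm 2.3 framework — their SDE Thm 4.4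
Assumption 5 fails here, so verify Assumptions 1–3 via CEHR2018 (2.5)/Carmona2007 Thm 1.1(iv)
weighted spectral gap). N = 0, 1: totalCurrent ≡ 0, D = 0. Together with 0706 gives 0705. -/
@[route_item "route-AtomisticToContinuum-OddSectorIrreversibility", crux]
def FiniteResponseOfUnique : Prop :=
  ∀ ω₂ lam β γ : ℝ, 0 < ω₂ → 0 < lam → 0 < β → 0 < γ → (∀ (N : ℕ) (T_L T_R : ℝ), 0 < T_L → 0 < T_R → ∀ μ ν : MeasureTheory.Measure (Literature.MathematicalPhysics.KineticTheory.HeatConduction.PhaseSpace N), (Literature.MathematicalPhysics.KineticTheory.HeatConduction.pinnedChain ω₂ lam β γ).IsSteadyState N T_L T_R μ → (Literature.MathematicalPhysics.KineticTheory.HeatConduction.pinnedChain ω₂ lam β γ).IsSteadyState N T_L T_R ν → μ = ν) → ∀ μ : (N : ℕ) → ℝ → ℝ → MeasureTheory.Measure (Literature.MathematicalPhysics.KineticTheory.HeatConduction.PhaseSpace N), (∀ (N : ℕ) (T_L T_R : ℝ), 0 < T_L → 0 < T_R → (Literature.MathematicalPhysics.KineticTheory.HeatConduction.pinnedChain ω₂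 lam β γ).IsSteadyState N T_L T_R (μ N T_L T_R)) → ∀ T : ℝ, 0 < T → ∀ N : ℕ, ∃ D : ℝ, Filter.Tendsto (fun δ : ℝ => (Literature.MathematicalPhysics.KineticTheory.HeatConduction.pinnedChain ω₂ lam β γ).totalCurrent (μ N (T + δ / 2) (T - δ / 2)) / δ) (nhdsWithin 0 {(0 : ℝ)}ᶜ) (nhds D)

-- `FiniteResponseOfUnique` holds: proved by `Summit.AtomisticToContinuum.FouriersLaw.Theorems.FourierGreenKubo.finiteResponseOfUnique_holds` (its module imports this route file, so no `_holds` link can be stated here).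

/-- item stmt-AtomisticToContinuum-0741 · crux · rank 9 · closed · proved by Summit.AtomisticToContinuum.FouriersLaw.Theorems.nessUnique_proof (prover) · by planner
why it might fail: Print has only invariant-MEASURE uniqueness (CEHR2018 Thm 2.13(1), Carmona2007); the item needs weak L*μ=0 on C_c^∞ ⇒ P_t-invariant for a DEGENERATE L with cubic forces; FPK probability solutions can be non-unique without a Lyapunov function (BKRS2015 Ch. 4–5): e^{θH} must drive an Ethier–Kurtz step
sources: CuneoEckmannHairerReyBellet2018, Carmona2007, EthierKurtz1986, BogachevKrylovRocknerShaposhnikov2015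
[crux] UNIQUENESS OF THE WEAK STEADY STATE (the half of stmt-0706 not covered by the landed fact
Literature.MathematicalPhysics.KineticTheory.HeatConduction.CuneoEckmannHairerReyBellet2018_pinnedChain,
p3544): for pinnedChain ω₂ lam β γ (all > 0), every N and T_L, T_R > 0, any two measures in the weak
Fokker–Planck class IsSteadyState (probability, ∫ L f dμ = 0 for f ∈ C_c^∞, bond currents
integrable) coincide. Print: uniqueness of the INVARIANT MEASURE of the Langevin semigroup
(CuneoEckmannHairerReyBellet2018 Thm 2.13(1): C1, C2, CA; Carmona2007 Thm 1.1(iii)); the item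
additionally needs 'weak stationary probability solution of L*μ = 0 ⇒ P_t-invariant' for this
hypoelliptic L with cubic drift (Echeverría 1982 well-posed martingale problem on C_c^∞ +
non-explosion via e^{θH}; Bogachev–Krylov–Röckner–Shaposhnikov 2015 Ch. 5 is non-degenerate only) —
the FP-identification lemma is the formal crux. N = 0: PhaseSpace 0 is a point (unique probability
measure); N = 1: both baths on site 0, OU at temperature (T_L+T_R)/2. This is exactly the hypothesis
of FiniteResponse and ThermodynamicLimit and, with the fact, gives clause (i) of FouriersLawFor. -/
@[route_item "route-AtomisticToContinuum-OddSectorIrreversibility", crux]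
def NessUnique : Prop :=
  ∀ ω₂ lam β γ : ℝ, 0 < ω₂ → 0 < lam → 0 < β → 0 < γ → ∀ (N : ℕ) (T_L T_R : ℝ), 0 < T_L → 0 < T_R → ∀ μ ν : MeasureTheory.Measure (Literature.MathematicalPhysics.KineticTheory.HeatConduction.PhaseSpace N), (Literature.MathematicalPhysics.KineticTheory.HeatConduction.pinnedChain ω₂ lam β γ).IsSteadyState N T_L T_R μ → (Literature.MathematicalPhysics.KineticTheory.HeatConduction.pinnedChain ω₂ lam β γ).IsSteadyState N T_L T_R ν → μ = ν

/-- `NessUnique` holds: proved by `Summit.AtomisticToContinuum.FouriersLaw.Theorems.nessUnique_proof`. -/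
theorem NessUnique_holds : NessUnique := _root_.Summit.AtomisticToContinuum.FouriersLaw.Theorems.nessUnique_proof

-- earlier WitnessGlue (stmt-AtomisticToContinuum-14072, replaced 2026-08-16T07:51:11Z -> stmt-AtomisticToContinuum-15094): retired by None — CorrectorTheory → ClosedConeSensitivity → ConeScaleCorrector → SubBallisticWindow → GibbsSteadyState → NessUnique → BoundedResponse
-- earlier WitnessGlue (stmt-AtomisticToContinuum-15094, replaced 2026-08-16T07:57:06Z -> stmt-AtomisticToContinuum-15120): retired by None — ClosedConeSensitivity → ConeScaleCorrector → SubBallisticWindow → BoundedResponse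
-- earlier WitnessGlue (stmt-AtomisticToContinuum-15120, replaced 2026-08-16T09:41:16Z -> stmt-AtomisticToContinuum-15160): retired by None — ClosedConeSensitivity → ConeScaleCorrector → SubBallisticWindow → ∀ ω₂ lam β γ : ℝ, 0 < ω₂ → 0 < lam → 0 < β → 0 < γ → (∀ (N : ℕ) (T_L T_R : ℝ), 0 < T_L → 0 < T_R → ∀ μ ν : MeasureTheory.Measure (Literature.MathematicalPhysics.KineticTheory.HeatConduction.Phase
/-- item stmt-AtomisticToContinuum-15160 · crux · rank 9 · closed · proved by Summit.AtomisticToContinuum.FouriersLaw.Theorems.OddSectorWitness.TapLeak.witnessGlue_proof (prover) · by planner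
why it might fail: Bookkeeping only if P holds N-uniformly at order 3/2 (exactly marginal: Σ_d d^{1/2} ≍ N^{3/2}) AND the fixed-N lemma CorrectorTheory lands (unweighted L²(μ_T) corrector limit, bond sum rule, leak identity vs the closed flow); constants a, C₁, C₂ blow up in the cold / harmonic corner.
sources: KunduDharNarayan2009, LepriLiviPoliti2003, CuneoEckmannHairerReyBellet2018, Literature.Barriers.AtomisticToContinuum.HasBoundedResponse
[crux] (rank-9 slot; REV 17 body of the TRANSPORT-WITNESS THEOREM after the E3 route-choice: the
leak is bounded by the tap-leak budget P = TapLeakBound instead of the tangent cone) TapLeakBound →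
ConeScaleCorrector → SubBallisticWindow → ⟨BoundedResponse, definiens verbatim (cruxes print before
supports; `Iff.rfl`)⟩: the three N-uniform cruxes give length-uniform bounded response along every
steady-state family under uniqueness. PROOF SHAPE (bookkeeping over the fixed-N LEMMA
CorrectorTheory A(1)–(7)+B and GibbsSteadyState ✓; no further N-uniform input): π = μ_T/Z; windows
τ_i = 2^{⌊log₂(a d_i/2)⌋} with a from P; lower side ⟨u⁻, W⟩ = 2T²D_N Σ_iτ_i + 2Σ_i∫₀^{τ_i}leak_i
(bond sum rule, KDN normalisation); leak_i(t) = −γT∫₀^tΣ_b⟨∂_b u⁺, ∂_b(j_i∘Φ_s)⟩ds (CorrectorTheory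
(7)), |leak_i(t)| ≤ γ·2C·Z√(1 + (N−1)T²D_N)·t·(1 + d_i/2)^{−3/2} for t ≤ τ_i ≤ a d_i/2 (P at both
contacts, s ≤ a d_i/2 ≤ a d′), so Σ_iτ_i∫₀^{τ_i}|leak_i| ≲ Z√(N D_N)·a²Σ_i d_i^{1/2} ≲ Z N²√D_N;
upper side ‖u⁻‖_π‖W‖_π ≤ √C₁N·√(C₂′Σ_iτ_i) (E1; E2 on dyadic time shells of the central blocks B_m =
{i : τ_i ≥ 2^m} by Φ- and Θ-invariance of μ_T); Σ_iτ_i ≥ aN²/32 ⇒ D_N ≤ A + B√D_N ⇒ sup_N D_N < ∞ (0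
≤ D_N by the tap identity -/
@[route_item "route-AtomisticToContinuum-OddSectorIrreversibility", crux]
def WitnessGlue : Prop :=
  TapLeakBound → ConeScaleCorrector → SubBallisticWindow → ∀ ω₂ lam β γ : ℝ, 0 < ω₂ → 0 < lam → 0 < β → 0 < γ → (∀ (N : ℕ) (T_L T_R : ℝ), 0 < T_L → 0 < T_R → ∀ μ ν : MeasureTheory.Measure (Literature.MathematicalPhysics.KineticTheory.HeatConduction.PhaseSpace N), (Literature.MathematicalPhysics.KineticTheory.HeatConduction.pinnedChain ω₂ lam β γ).IsSteadyState N T_L T_R μ → (Literature.MathematicalPhysics.KineticTheory.HeatConduction.pinnedChain ω₂ lam β γ).IsSteadyState N T_L T_R ν → μ = ν) → ∀ μ : (N : ℕ) → ℝ → ℝ → MeasureTheory.Measure (Literature.MathematicalPhysics.KineticTheory.HeatConduction.PhaseSpace N), (∀ (N : ℕ) (T_L T_R : ℝ), 0 < T_L → 0 < T_R → (Literature.MathematicalPhysics.KineticTheory.HeatConduction.pinnedChain ω₂ lam β γ).IsSteadyState N T_L T_R (μ N T_L T_R)) → ∀ T : ℝ, 0 < T → ∀ D : ℕ → ℝ,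 (∀ N : ℕ, Filter.Tendsto (fun δ : ℝ => (Literature.MathematicalPhysics.KineticTheory.HeatConduction.pinnedChain ω₂ lam β γ).totalCurrent (μ N (T + δ / 2) (T - δ / 2)) / δ) (nhdsWithin 0 {(0 : ℝ)}ᶜ) (nhds (D N))) → BddAbove (Set.range fun N => |D N|)

-- `WitnessGlue` holds: proved by `Summit.AtomisticToContinuum.FouriersLaw.Theorems.OddSectorWitness.TapLeak.witnessGlue_proof` (its module imports this route file, so no `_holds` link can be stated here).

/-- item stmt-AtomisticToContinuum-9140 · support · rank 3 · open · by planner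
why it might fail: Sufficient, not necessary: long-range first-order ODD (q–p) NESS correlations, δ/N over ≍N² pairs, would give ∫(h−hΘ)² ≍ 1 with Fourier intact (solvable BLL2004: ≍1/N exactly; RLL harmonic: ≍N); nothing N-uniform is known for the NESS density of any deterministic anharmonic chain (BLR2000 §6.3).
sources: KomatsuNakagawaSasaTasaki2011, SpinneyFord2012, MaesNetocny2010, BonettoLebowitzLukkarinen2004, RiederLebowitzLieb1967, BernardinOlla2005
[crux] (SI, card items 2/5 — the X of the thesis) under weak-NESS uniqueness, for every steady-state
family μ and T > 0 there is C with: for all N ≥ 2 and every h that is the L²(μ_{N,T,T})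
linear-response density of δ ↦ μ_{N,T+δ/2,T−δ/2} at δ = 0 (weak derivative on C_c^∞ observables AND
on the bond currents — the predicate pins h down uniquely; existence is the separate support item
ResponseDensity, so nothing is smuggled), h − h∘Θ ∈ L²(μ_{N,T,T}) and N·∫(h − h∘Θ)² dμ_{N,T,T} ≤ C.
Equivalent readings: b_N = KL(NESS‖Θ NESS) = O(δ²/N) (ReversalKLSecondOrder); ‖P_odd u_N‖² = O(N)
for the Kubo corrector (OddDensityIsCorrector). Benchmarks (planner, exact): BLL2004 self-consistent
chain N·∫(h−hΘ)² = 0.87 ↘ 0.79 for N = 3…12 (decreasing); RLL harmonic chain ∫(h−hΘ)² ≈ 0.33·N.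
[deps: OddCorrectorDecay] [difficulty: open-problem] -/
@[route_item "route-AtomisticToContinuum-OddSectorIrreversibility"]
def OddResponseBound : Prop :=
  ∀ ω₂ lam β γ : ℝ, 0 < ω₂ → 0 < lam → 0 < β → 0 < γ → (∀ (N : ℕ) (T_L T_R : ℝ), 0 < T_L → 0 < T_R → ∀ μ ν : MeasureTheory.Measure (Literature.MathematicalPhysics.KineticTheory.HeatConduction.PhaseSpace N), (Literature.MathematicalPhysics.KineticTheory.HeatConduction.pinnedChain ω₂ lam β γ).IsSteadyState N T_L T_R μ → (Literature.MathematicalPhysics.KineticTheory.HeatConduction.pinnedChain ω₂ lam β γ).IsSteadyState N T_L T_R ν → μ = ν) → ∀ μ : (N : ℕ) → ℝ → ℝ → MeasureTheory.Measure (Literature.MathematicalPhysics.KineticTheory.HeatConduction.PhaseSpace N), (∀ (N : ℕ) (T_L T_R : ℝ), 0 < T_L → 0 < T_R → (Literature.MathematicalPhysics.KineticTheory.HeatConduction.pinnedChain ω₂ lam β γ).IsSteadyState N T_L T_R (μ N T_L T_R)) → ∀ T : ℝ, 0 < T → ∃ C : ℝ, ∀ (N : ℕ) (h : Literature.MathematicalPhysics.KineticTheory.HeatConduction.PhaseSpace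 N → ℝ), 2 ≤ N → (MeasureTheory.MemLp h 2 (μ N T T) ∧ (∀ F : Literature.MathematicalPhysics.KineticTheory.HeatConduction.PhaseSpace N → ℝ, ContDiff ℝ ((⊤ : ℕ∞) : WithTop ℕ∞) F → HasCompactSupport F → Filter.Tendsto (fun δ : ℝ => ((∫ x, F x ∂(μ N (T + δ / 2) (T - δ / 2))) - ∫ x, F x ∂(μ N T T)) / δ) (nhdsWithin 0 {(0 : ℝ)}ᶜ) (nhds (∫ x, F x * h x ∂(μ N T T)))) ∧ (∀ i : Fin N, Filter.Tendsto (fun δ : ℝ => ((∫ x, (Literature.MathematicalPhysics.KineticTheory.HeatConduction.pinnedChain ω₂ lam β γ).bondCurrent N i x ∂(μ N (T + δ / 2) (T - δ / 2))) - ∫ x, (Literature.MathematicalPhysics.KineticTheory.HeatConduction.pinnedChain ω₂ lam β γ).bondCurrent N i x ∂(μ N T T)) / δ) (nhdsWithin 0 {(0 : ℝ)}ᶜ) (nhds (∫ x, (Literature.MathematicalPhysics.KineticTheory.HeatConduction.pinnedChain ω₂ lam β γ).bondCurrent N i x * h x ∂(μ N T T))))) → MeasureTheory.MemLp (fun x :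 Literature.MathematicalPhysics.KineticTheory.HeatConduction.PhaseSpace N => h x - h (x.1, -x.2)) 2 (μ N T T) ∧ (N : ℝ) * ∫ x, (h x - h (x.1, -x.2)) ^ 2 ∂(μ N T T) ≤ C

/-- item stmt-AtomisticToContinuum-0718 · support · rank 9 · closed · proved by Summit.AtomisticToContinuum.FouriersLaw.Theorems.GibbsSteadyState_proof (prover) · by planner
sources: BonettoLebowitzReyBellet2000
EQUILIBRIUM ANCHOR (refuter pool-5 on 0706: "a good Lean warm-up"; de-vacuifies IsSteadyState and
pins δ = 0 in 0705/0717): for pinnedChain ω₂ lam β γ (all > 0), every N and T > 0, the Gibbs measure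
Z⁻¹ e^{−H_N(q,p)/T} d q d p (Z = ∫ e^{−H/T} ∈ (0,∞): H ≥ Σ p²/2 + ω₂ q²/2, polynomial growth) is a
weak steady state with T_L = T_R = T — probability ✓; ∫ L f dμ = 0 for f ∈ C_c^∞ by Liouville
(Hamiltonian part: integrate by parts, {H, e^{−H/T}} = 0) and by ∫ (T ∂_p² f − p ∂_p f) e^{−p²/2T}
dp = 0 for the two Ornstein–Uhlenbeck bath terms; bond currents j_i = −½(p_i + p_{i+1})V′(q_{i+1} −
q_i) are integrable (Gaussian in p × e^{−(V+U)/T}) and have mean 0 (odd in p) ⇒ totalCurrent = 0.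
Sources: BonettoLebowitzReyBellet2000 §4.1 (10)–(11) (Gibbs is stationary at equal temperatures);
folklore. -/
@[route_item "route-AtomisticToContinuum-OddSectorIrreversibility"]
def GibbsSteadyState : Prop :=
  ∀ ω₂ lam β γ : ℝ, 0 < ω₂ → 0 < lam → 0 < β → 0 < γ → ∀ (N : ℕ) (T : ℝ), 0 < T → ∃ Z : ℝ, 0 < Z ∧ (Literature.MathematicalPhysics.KineticTheory.HeatConduction.pinnedChain ω₂ lam β γ).IsSteadyState N T T ((ENNReal.ofReal Z)⁻¹ • MeasureTheory.volume.withDensity (fun x => ENNReal.ofReal (Real.exp (-(Literature.MathematicalPhysics.KineticTheory.HeatConduction.pinnedChain ω₂ lam β γ).hamiltonian N x / T)))) ∧ (Literature.MathematicalPhysics.KineticTheory.HeatConduction.pinnedChain ω₂ lam β γ).totalCurrent ((ENNReal.ofReal Z)⁻¹ • MeasureTheory.volume.withDensity (fun x => ENNReal.ofReal (Real.exp (-(Literature.MathematicalPhysics.KineticTheory.HeatConduction.pinnedChain ω₂ lam β γ).hamiltonian N x / T)))) = 0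

-- `GibbsSteadyState` holds: proved by `Summit.AtomisticToContinuum.FouriersLaw.Theorems.GibbsSteadyState_proof` (its module imports this route file, so no `_holds` link can be stated here).

-- earlier BoundedResponse (stmt-AtomisticToContinuum-9142, replaced 2026-08-15T16:32:04Z -> stmt-AtomisticToContinuum-10924): retired by None — ∀ ω₂ lam β γ : ℝ, 0 < ω₂ → 0 < lam → 0 < β → 0 < γ → (∀ (N : ℕ) (T_L T_R : ℝ), 0 < T_L → 0 < T_R → ∀ μ ν : MeasureTheory.Measure (Literature.MathematicalPhysics.KineticTheory.HeatConduction.PhaseSpace N), (Literature.MathematicalPhysics.KineticTheory.HeatCon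
/-- item stmt-AtomisticToContinuum-10924 · support · rank 9 · open · by planner
sources: BonettoLebowitzReyBellet2000, Literature.Barriers.AtomisticToContinuum.hasBoundedResponse_iff, Literature.Barriers.AtomisticToContinuum.hasBoundedResponse_iff_of_unique
[support] (= the catalogued necessary waypoint
`Literature.Barriers.AtomisticToContinuum.HasBoundedResponse (pinnedChain ω₂ lam β γ)` under
weak-NESS uniqueness, WRITTEN OUT — definiens verbatim, `hasBoundedResponse_iff` is `Iff.rfl`, so
the old and new decls are definitionally equal (planner Sketch.lean: `example : BoundedResponseR ↔
BoundedResponse := Iff.rfl`, rc 0); provers may still go through `hasBoundedResponse_iff_of_unique`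
(PROVED) by importing FixedLengthNoConductivityControl in their Theorems file) for all parameters >
0, assuming uniqueness of weak steady states (IsSteadyState class), along EVERY steady-state family
μ and every T > 0: if D_N = lim_{δ→0, δ≠0} totalCurrent(μ_{N,T+δ/2,T−δ/2})/δ exists for all N then
(|D_N|)_N is bounded — BLR2000 §6.3's missing 'dependence of D on L' in its weakest quantitative
form; closed in this route by OddSufficiency from OddResponseBound (one Cauchy–Schwarz). Cone repair
2026-08-15 (rev 3): the Barriers PREDICATE carried [cite] doc tags and no `_holds` (it is
vocabulary, explicit binder P), so the staffability audit (#h21_route_deps) listed it as an unproved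
cite-only dependency; unfolding removes the name from the decl cone without -/
@[route_item "route-AtomisticToContinuum-OddSectorIrreversibility", crux]
def BoundedResponse : Prop :=
  ∀ ω₂ lam β γ : ℝ, 0 < ω₂ → 0 < lam → 0 < β → 0 < γ → (∀ (N : ℕ) (T_L T_R : ℝ), 0 < T_L → 0 < T_R → ∀ μ ν : MeasureTheory.Measure (Literature.MathematicalPhysics.KineticTheory.HeatConduction.PhaseSpace N), (Literature.MathematicalPhysics.KineticTheory.HeatConduction.pinnedChain ω₂ lam β γ).IsSteadyState N T_L T_R μ → (Literature.MathematicalPhysics.KineticTheory.HeatConduction.pinnedChain ω₂ lam β γ).IsSteadyState N T_L T_R ν → μ = ν) → ∀ μ : (N : ℕ) → ℝ → ℝ → MeasureTheory.Measure (Literature.MathematicalPhysics.KineticTheory.HeatConduction.PhaseSpace N), (∀ (N : ℕ) (T_L T_R : ℝ), 0 < T_L → 0 < T_R → (Literature.MathematicalPhysics.KineticTheory.HeatConduction.pinnedChain ω₂ lam β γ).IsSteadyState N T_L T_R (μ N T_L T_R)) → ∀ T : ℝ, 0 < T → ∀ D : ℕ → ℝ, (∀ N : ℕ, Filter.Tendsto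 (fun δ : ℝ => (Literature.MathematicalPhysics.KineticTheory.HeatConduction.pinnedChain ω₂ lam β γ).totalCurrent (μ N (T + δ / 2) (T - δ / 2)) / δ) (nhdsWithin 0 {(0 : ℝ)}ᶜ) (nhds (D N))) → BddAbove (Set.range fun N => |D N|)

/-- item stmt-AtomisticToContinuum-14071 · support · rank 9 · closed · proved by Summit.AtomisticToContinuum.FouriersLaw.Theorems.OddSectorIrreversibility.Corrector.CorrectorTheory_proof (prover) · by planner
sources: KunduDharNarayan2009, arXiv:0809.4543, CuneoEckmannHairerReyBellet2018, MaesNetocny2010, ReyBellet2003, HairerMajda2009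
[support] (fixed N; TWO CONJUNCTS, one item because of the 15-item cap; L) CONJUNCT A —
CorrectorCalculus, THE FIRST CHECKABLE STATEMENT of the line: for every N, for the equilibrium OPEN
chain at T there is u (the Kubo corrector of J_tot) with (1) u ∈ C¹; (2) u ∈ L²(μ_T); (3) u_τ :=
∫₀^τ P_tJ_tot dt → u μ_T-a.e. and (4) in L²(μ_T) as τ → ∞ (fixed-N exponential ergodicity CEHR2018
(2.5) / pinnedChainSemigroup_ergodic; hypoelliptic regularity makes u smooth with L u = −J_tot); (5)
BOND SUM RULE ∫u·j_i dμ_T = ∫u·j_{i+1} dμ_T whenever site i+1 is interior (i+2 < N) — ⟨u, A e_{i+1}⟩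
= −⟨Au, e_{i+1}⟩ = ⟨J + Su, e_{i+1}⟩ = 0, KDN (reln3) at corrector level: every bond pairs with u
like ⟨u,J⟩/(N−1); (6) TAP ENERGY IDENTITY γT(∫(∂_{p_0}u)² + ∫(∂_{p_{N−1}}u)²) = ∫u·J_tot (= −⟨Lu,u⟩
= −⟨Su,u⟩: gives D_N ≥ 0 and the leak budget); (7) LEAK IDENTITY against the CLOSED flow Φ
(zero-friction kernels): ⟨u⁻, j_i∘Φ_t⟩ − ⟨u⁻, j_i⟩ = −γT ∫₀^t Σ_{b∈{0,N−1}} ⟨∂_{p_b}u⁺,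
∂_{p_b}(j_i∘Φ_s)⟩ ds with u^∓ = (u ∓ u∘Θ)/2, Θ(q,p) = (q,−p) — d/dt⟨u⁻, j_i∘Φ_t⟩ = ⟨u⁻, A(j_i∘Φ_t)⟩
= −⟨Au⁻, ·⟩ = ⟨Su⁺, ·⟩ by the parity split of Lu = −J_tot (EVEN part Au⁻ + Su⁺ = 0; A = Liouvillian
flips Θ-parity, S = the two OU taps p -/
@[route_item "route-AtomisticToContinuum-OddSectorIrreversibility", crux]
def CorrectorTheory : Prop :=
  (∀ ω₂ lam β γ : ℝ, 0 < ω₂ → 0 < lam → 0 < β → 0 < γ → ∀ T : ℝ, 0 < T → ∀ N : ℕ, let P := Literature.MathematicalPhysics.KineticTheory.HeatConduction.pinnedChain ω₂ lam β γ; let P₀ := Literature.MathematicalPhysics.KineticTheory.HeatConduction.pinnedChain ω₂ lam β 0; let μT : MeasureTheory.Measure (Literature.MathematicalPhysics.KineticTheory.HeatConduction.PhaseSpace N) := MeasureTheory.volume.withDensity (fun x : Literature.MathematicalPhysics.KineticTheory.HeatConduction.PhaseSpace N => ENNReal.ofReal (Real.exp (-(P.hamiltonian N x) / T))); let J : Literature.MathematicalPhysics.KineticTheory.HeatConduction.PhaseSpace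 N → ℝ := fun z => ∑ i : Fin N, P.bondCurrent N i z; ∃ u : Literature.MathematicalPhysics.KineticTheory.HeatConduction.PhaseSpace N → ℝ, ContDiff ℝ 1 u ∧ MeasureTheory.MemLp u 2 μT ∧ (∀ᵐ x ∂μT, Filter.Tendsto (fun τ : ℝ => ∫ t in Set.Ioc (0 : ℝ) τ, (∫ y, J y ∂(P.transitionKernel N T T t.toNNReal x))) Filter.atTop (nhds (u x))) ∧ Filter.Tendsto (fun τ : ℝ => ∫ x, ((∫ t in Set.Ioc (0 : ℝ) τ, (∫ y, J y ∂(P.transitionKernel N T T t.toNNReal x))) - u x) ^ 2 ∂μT) Filter.atTop (nhds 0) ∧ (∀ i i' : Fin N, i'.val = i.val + 1 → i'.val + 1 < N → ∫ x, u x * P.bondCurrent N i x ∂μT = ∫ x, u x * P.bondCurrent N i' x ∂μT) ∧ (∀ b₀ b₁ : Fin N, b₀.val = 0 → b₁.val = N - 1 → γ * T * ((∫ x, (Literature.MathematicalPhysics.KineticTheory.HeatConduction.partialP b₀ u x) ^ 2 ∂μT) + ∫ x, (Literature.MathematicalPhysics.KineticTheory.HeatConduction.partialP b₁ u x) ^ 2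 ∂μT) = ∫ x, u x * J x ∂μT) ∧ (∀ (i b₀ b₁ : Fin N) (t : ℝ), b₀.val = 0 → b₁.val = N - 1 → 0 ≤ t → let uo : Literature.MathematicalPhysics.KineticTheory.HeatConduction.PhaseSpace N → ℝ := fun x => (u x - u (x.1, -x.2)) / 2; let ue : Literature.MathematicalPhysics.KineticTheory.HeatConduction.PhaseSpace N → ℝ := fun x => (u x + u (x.1, -x.2)) / 2; let jt : ℝ → Literature.MathematicalPhysics.KineticTheory.HeatConduction.PhaseSpace N → ℝ := fun s x => ∫ y, P.bondCurrent N i y ∂(P₀.transitionKernel N T T s.toNNReal x); (∫ x, uo x * jt t x ∂μT) - (∫ x, uo x * P.bondCurrent N i x ∂μT) = -(γ * T) * ∫ s in Set.Ioc (0 : ℝ) t, ((∫ x, Literature.MathematicalPhysics.KineticTheory.HeatConduction.partialP b₀ ue x * Literature.MathematicalPhysics.KineticTheory.HeatConduction.partialP b₀ (jt s) x ∂μT) + ∫ x, Literature.MathematicalPhysics.KineticTheory.HeatConduction.partialP b₁ ue x * Literature.MathematicalPhysics.KineticTheory.HeatConduction.partialP b₁ (jt s) x ∂μT))) ∧ (∀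 ω₂ lam β γ : ℝ, 0 < ω₂ → 0 < lam → 0 < β → 0 < γ → let P := Literature.MathematicalPhysics.KineticTheory.HeatConduction.pinnedChain ω₂ lam β γ; (∀ (N : ℕ) (T_L T_R : ℝ), 0 < T_L → 0 < T_R → ∀ μ ν : MeasureTheory.Measure (Literature.MathematicalPhysics.KineticTheory.HeatConduction.PhaseSpace N), P.IsSteadyState N T_L T_R μ → P.IsSteadyState N T_L T_R ν → μ = ν) → ∀ μ : (N : ℕ) → ℝ → ℝ → MeasureTheory.Measure (Literature.MathematicalPhysics.KineticTheory.HeatConduction.PhaseSpace N), (∀ (N : ℕ) (T_L T_R : ℝ), 0 < T_L → 0 < T_R → P.IsSteadyState N T_L T_R (μ N T_L T_R)) → ∀ T : ℝ, 0 < T → ∀ (N : ℕ) (D : ℝ), Filter.Tendsto (fun δ : ℝ => P.totalCurrent (μ N (T + δ / 2) (T - δ / 2)) / δ) (nhdsWithin 0 {(0 : ℝ)}ᶜ) (nhds D) → let J : Literature.MathematicalPhysics.KineticTheory.HeatConduction.PhaseSpace N → ℝ := fun z => ∑ i : Fin N, P.bondCurrent N i z; MeasureTheory.IntegrableOn (fun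 t : ℝ => ∫ z, J z * (∫ y, J y ∂(P.transitionKernel N T T t.toNNReal z)) ∂(P.gibbsMeasure N T)) (Set.Ioi 0) ∧ ((N : ℝ) - 1) * T ^ 2 * D = ∫ t in Set.Ioi (0 : ℝ), ∫ z, J z * (∫ y, J y ∂(P.transitionKernel N T T t.toNNReal z)) ∂(P.gibbsMeasure N T))

-- `CorrectorTheory` holds: proved by `Summit.AtomisticToContinuum.FouriersLaw.Theorems.OddSectorIrreversibility.Corrector.CorrectorTheory_proof` (its module imports this route file, so no `_holds` link can be stated here).

-- earlier ClosedConeSensitivity (stmt-AtomisticToContinuum-14059, replaced 2026-08-16T09:41:16Z -> stmt-AtomisticToContinuum-15159): retired by None — ∀ ω₂ lam β γ : ℝ, 0 < ω₂ → 0 < lam → 0 < β → 0 < γ → ∀ T : ℝ, 0 < T → ∃ a κ C : ℝ, 0 < a ∧ 0 < κ ∧ ∀ (N : ℕ) (i b : Fin N) (t s : ℝ), (b.val = 0 ∨ b.val = N - 1) → 0 ≤ t → 0 < s → s ≤ 1 → let P := Literature.MathematicalPhysics.KineticTheory.HeatCondu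
/-- item stmt-AtomisticToContinuum-15162 · support · rank 9 · open · by planner
sources: MarchioroPellegrinottiPulvirenti1978, ButtaEtAl2007, ButtaMarchioro2016, RazSims2009, NachtergaeleEtAl2008, KumarEtAl2020
[support] SETTLED-NEGATIVE EDGE since rev 17 (route-choice seat 4801cdfb) — the rev-4 crux E3,
re-attached as SUPPORT with the decl VERBATIM because
Theorems/ClosedConeSensitivity/Negative/{ZeroFrictionDictionary (p80812), TangentReduction
(p82694)}.lean unfold it and are opened by OddSectorIrreversibilityCorrectorTheory.lean /
…SubBallisticWindowCoboundaryCeiling.lean. DO NOT STAFF POSITIVELY (held): as typed (C·s² for every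
s ∈ (0,1]) it is an N-uniform L²(Gibbs) bound on the TANGENT entry ∂_{p_b}(j_i∘Φ_t) on linear rays
(tangentBoundAt_of_closedConeSensitivity), judged false at every admissible parameter point by the
line lead (MISSTATED.md), the standing disprover (Disproof.lean §2: hot quartic clusters, rate ≈
0.05e^{1/4}, Gibbs price independent of d; tube amplifiers), ideators k1–k5 and triage r1×3 / r2×3;
refutation interface closedConeSensitivity_false_of_rayBlowup awaits a constructible
TangentRayBlowup / EndTubeAmplifier″ (cdisprove cycle 2). Successor: the crux TapLeakBound (P) ⇐
ResampledKickCone + BoundaryHermiteRegularity. Original gloss: (E3) mean-square causality of the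
closed flow, ∃ a κ C ∀ N i b, t ≤ a·d, s ∈ (0,1]: ∫(j_i(Φ_t(q, p + s·e_b)) − j_i(Φ_t(q,p)))² dμ_ -/
@[route_item "route-AtomisticToContinuum-OddSectorIrreversibility"]
def ClosedConeSensitivity : Prop :=
  ∀ ω₂ lam β γ : ℝ, 0 < ω₂ → 0 < lam → 0 < β → 0 < γ → ∀ T : ℝ, 0 < T → ∃ a κ C : ℝ, 0 < a ∧ 0 < κ ∧ ∀ (N : ℕ) (i b : Fin N) (t s : ℝ), (b.val = 0 ∨ b.val = N - 1) → 0 ≤ t → 0 < s → s ≤ 1 → let P := Literature.MathematicalPhysics.KineticTheory.HeatConduction.pinnedChain ω₂ lam β γ; let P₀ := Literature.MathematicalPhysics.KineticTheory.HeatConduction.pinnedChain ω₂ lam β 0; let μT : MeasureTheory.Measure (Literature.MathematicalPhysics.KineticTheory.HeatConduction.PhaseSpace N) := MeasureTheory.volume.withDensity (fun x : Literature.MathematicalPhysics.KineticTheory.HeatConduction.PhaseSpace N => ENNReal.ofReal (Real.exp (-(P.hamiltonian N x) / T))); let d : ℕ := (if b.val = 0 then i.val else N - 2 - i.val); t ≤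 a * (d : ℝ) → ∫ x, ((∫ y, P.bondCurrent N i y ∂(P₀.transitionKernel N T T t.toNNReal (x.1, Function.update x.2 b (x.2 b + s)))) - (∫ y, P.bondCurrent N i y ∂(P₀.transitionKernel N T T t.toNNReal x))) ^ 2 ∂μT ≤ C * s ^ 2 * Real.exp (-(κ * ((d : ℝ) - t / a))) * ∫ x, Real.exp (-(P.hamiltonian N x) / T) ∂MeasureTheory.volume

/-- item stmt-AtomisticToContinuum-9144 · support · rank 9 · closed · proved by Summit.AtomisticToContinuum.FouriersLaw.Theorems.OddSectorIrreversibility.Corrector.responseDensity_holds (prover) · by planner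
sources: HairerMajda2009, ReyBellet2003, CuneoEckmannHairerReyBellet2018, EckmannPilletReyBellet1999b
[support] (card item 1, fixed-N regularity; existence half of the interface used by
OddResponseBound) under uniqueness, for every family, T > 0 and N there is h ∈ L²(μ_{N,T,T}) with
d/dδ ∫F dμ_{N,T+δ/2,T−δ/2}|₀ = ∫ F h dμ_{N,T,T} for all F ∈ C_c^∞ and for F = each bond current
(limits along 𝓝[≠]0 of difference quotients). Content: Hairer–Majda linear response for the
hypoelliptic Langevin chain with Lyapunov function e^{θH} (CEHR (2.5)), plus ρ_δ/ρ_0 ∈ L²(μ_T) for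
|δ| < T (Gaussian-type tails). N = 1: both baths on one site at (T_L+T_R)/2 = T, so μ_δ ≡ μ_T and h
= 0. [difficulty: L] -/
@[route_item "route-AtomisticToContinuum-OddSectorIrreversibility", crux]
def ResponseDensity : Prop :=
  ∀ ω₂ lam β γ : ℝ, 0 < ω₂ → 0 < lam → 0 < β → 0 < γ → (∀ (N : ℕ) (T_L T_R : ℝ), 0 < T_L → 0 < T_R → ∀ μ ν : MeasureTheory.Measure (Literature.MathematicalPhysics.KineticTheory.HeatConduction.PhaseSpace N), (Literature.MathematicalPhysics.KineticTheory.HeatConduction.pinnedChain ω₂ lam β γ).IsSteadyState N T_L T_R μ → (Literature.MathematicalPhysics.KineticTheory.HeatConduction.pinnedChain ω₂ lam β γ).IsSteadyState N T_L T_R ν → μ = ν) → ∀ μ : (N : ℕ) → ℝ → ℝ → MeasureTheory.Measure (Literature.MathematicalPhysics.KineticTheory.HeatConduction.PhaseSpace N), (∀ (N : ℕ) (T_L T_R : ℝ), 0 < T_L → 0 < T_R → (Literature.MathematicalPhysics.KineticTheory.HeatConduction.pinnedChain ω₂ lam β γ).IsSteadyState N T_L T_R (μ N T_L T_R)) → ∀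 T : ℝ, 0 < T → ∀ N : ℕ, ∃ h : Literature.MathematicalPhysics.KineticTheory.HeatConduction.PhaseSpace N → ℝ, (MeasureTheory.MemLp h 2 (μ N T T) ∧ (∀ F : Literature.MathematicalPhysics.KineticTheory.HeatConduction.PhaseSpace N → ℝ, ContDiff ℝ ((⊤ : ℕ∞) : WithTop ℕ∞) F → HasCompactSupport F → Filter.Tendsto (fun δ : ℝ => ((∫ x, F x ∂(μ N (T + δ / 2) (T - δ / 2))) - ∫ x, F x ∂(μ N T T)) / δ) (nhdsWithin 0 {(0 : ℝ)}ᶜ) (nhds (∫ x, F x * h x ∂(μ N T T)))) ∧ (∀ i : Fin N, Filter.Tendsto (fun δ : ℝ => ((∫ x, (Literature.MathematicalPhysics.KineticTheory.HeatConduction.pinnedChain ω₂ lam β γ).bondCurrent N i x ∂(μ N (T + δ / 2) (T - δ / 2))) - ∫ x, (Literature.MathematicalPhysics.KineticTheory.HeatConduction.pinnedChain ω₂ lam β γ).bondCurrent N i x ∂(μ N T T)) / δ) (nhdsWithin 0 {(0 : ℝ)}ᶜ) (nhds (∫ x, (Literature.MathematicalPhysics.KineticTheory.HeatConduction.pinnedChain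 ω₂ lam β γ).bondCurrent N i x * h x ∂(μ N T T)))))

-- `ResponseDensity` holds: proved by `Summit.AtomisticToContinuum.FouriersLaw.Theorems.OddSectorIrreversibility.Corrector.responseDensity_holds` (its module imports this route file, so no `_holds` link can be stated here).

/-- item stmt-AtomisticToContinuum-9146 · support · rank 9 · closed · proved by Summit.AtomisticToContinuum.FouriersLaw.Theorems.OddSectorIrreversibility.oddDensityIsCorrector_proof @ 82ecb9ade4de (prover) · by planner
sources: KunduDharNarayan2009, MaesNetocny2010, CuneoEckmannHairerReyBellet2018, Literature.Barriers.AtomisticToContinuum.sum_bondCurrent_eq_poisson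
[support] (McLennan / KDN identity, fixed N ≥ 2; links ranks 2 and 3) for the response density h and
the equilibrium transition semigroup P_t: the Kubo corrector u(x) = lim_τ ∫₀^τ P_tJ_tot(x) dt exists
μ_T-a.e., u ∈ L²(μ_T), and h − h∘Θ = (u − u∘Θ)/((N−1)T²) a.e. Derivation (planner, NOTES.md):
differentiating weak stationarity in δ gives −L†h = g := γ(p_0² − p_{N−1}²)/(2T²) in L²(μ_T);
generalised detailed balance L† = ΘLΘ (KDN (reln2)) gives h = (∫₀^∞P_t g)∘Θ; the energy identities L
H_N = w_L + w_R (generator_hamiltonian_two_baths, PROVED) and L(Σ_k k e_k) = J_tot + (N−1)w_R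
(sum_bondCurrent_eq_poisson, PROVED; KDN (reln3)) kill the even parts and leave P_odd h = P_odd
u/((N−1)T²); consistency: D_N = ⟨J_tot,h⟩ = ⟨J_tot,u⟩/((N−1)T²) is KDN's open-chain Green–Kubo
formula. Convergence of ∫₀^∞P_tJ_tot: CEHR (2.5) in the e^{θH}-weighted norm, θ < 1/(2T). Formal
content: justify the δ-derivative of the weak Fokker–Planck equation (hypoelliptic regularity).
[difficulty: L] -/
@[route_item "route-AtomisticToContinuum-OddSectorIrreversibility", crux]
def OddDensityIsCorrector : Prop :=
  ∀ ω₂ lam β γ : ℝ, 0 < ω₂ → 0 < lam → 0 < β → 0 < γ → (∀ (N : ℕ) (T_L T_R : ℝ), 0 < T_L → 0 < T_R → ∀ μ ν : MeasureTheory.Measure (Literature.MathematicalPhysics.KineticTheory.HeatConduction.PhaseSpace N), (Literature.MathematicalPhysics.KineticTheory.HeatConduction.pinnedChain ω₂ lam β γ).IsSteadyState N T_L T_R μ → (Literature.MathematicalPhysics.KineticTheory.HeatConduction.pinnedChain ω₂ lam β γ).IsSteadyState N T_L T_R ν → μ = ν) → ∀ μ : (N : ℕ) → ℝ → ℝ →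 MeasureTheory.Measure (Literature.MathematicalPhysics.KineticTheory.HeatConduction.PhaseSpace N), (∀ (N : ℕ) (T_L T_R : ℝ), 0 < T_L → 0 < T_R → (Literature.MathematicalPhysics.KineticTheory.HeatConduction.pinnedChain ω₂ lam β γ).IsSteadyState N T_L T_R (μ N T_L T_R)) → ∀ T : ℝ, 0 < T → ∀ (N : ℕ) (h : Literature.MathematicalPhysics.KineticTheory.HeatConduction.PhaseSpace N → ℝ), 2 ≤ N → (MeasureTheory.MemLp h 2 (μ N T T) ∧ (∀ F : Literature.MathematicalPhysics.KineticTheory.HeatConduction.PhaseSpace N → ℝ, ContDiff ℝ ((⊤ : ℕ∞) : WithTop ℕ∞) F → HasCompactSupport F → Filter.Tendsto (fun δ : ℝ => ((∫ x, F x ∂(μ N (T + δ / 2) (T - δ / 2))) - ∫ x, F x ∂(μ N T T)) / δ) (nhdsWithin 0 {(0 : ℝ)}ᶜ) (nhds (∫ x, F x * h x ∂(μ N T T)))) ∧ (∀ i : Fin N, Filter.Tendsto (fun δ : ℝ => ((∫ x, (Literature.MathematicalPhysics.KineticTheory.HeatConduction.pinnedChain ω₂ lam β γ).bondCurrent N i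 x ∂(μ N (T + δ / 2) (T - δ / 2))) - ∫ x, (Literature.MathematicalPhysics.KineticTheory.HeatConduction.pinnedChain ω₂ lam β γ).bondCurrent N i x ∂(μ N T T)) / δ) (nhdsWithin 0 {(0 : ℝ)}ᶜ) (nhds (∫ x, (Literature.MathematicalPhysics.KineticTheory.HeatConduction.pinnedChain ω₂ lam β γ).bondCurrent N i x * h x ∂(μ N T T))))) → ∃ u : Literature.MathematicalPhysics.KineticTheory.HeatConduction.PhaseSpace N → ℝ, MeasureTheory.MemLp u 2 (μ N T T) ∧ (∀ᵐ x ∂(μ N T T), Filter.Tendsto (fun τ : ℝ => ∫ t in Set.Ioc (0 : ℝ) τ, (∫ y, (∑ i : Fin N, (Literature.MathematicalPhysics.KineticTheory.HeatConduction.pinnedChain ω₂ lam β γ).bondCurrent N i y) ∂((Literature.MathematicalPhysics.KineticTheory.HeatConduction.pinnedChain ω₂ lam β γ).transitionKernel N T T t.toNNReal x))) Filter.atTop (nhds (u x))) ∧ (∀ᵐ x ∂(μ N T T), h x - h (x.1, -x.2) = (u x - u (x.1, -x.2)) / (((N : ℝ) - 1) * T ^ 2))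

-- `OddDensityIsCorrector` holds: proved by `Summit.AtomisticToContinuum.FouriersLaw.Theorems.OddSectorIrreversibility.oddDensityIsCorrector_proof` @ 82ecb9ade4de (its module imports this route file, so no `_holds` link can be stated here).

-- earlier Assembly (stmt-AtomisticToContinuum-14058, replaced 2026-08-16T02:23:05Z -> stmt-AtomisticToContinuum-14068): retired by None — NessUnique → FiniteResponseOfUnique → BoundedResponse → BoundedResponseConverges → FouriersLaw
-- earlier Assembly (stmt-AtomisticToContinuum-14068, replaced 2026-08-16T07:51:11Z -> stmt-AtomisticToContinuum-15095): proved by Summit.AtomisticToContinuum.FouriersLaw.Theorems.oddSectorIrreversibility_assembly_proof @ 1ba5f271c66f — WitnessGlue → CorrectorTheory → ClosedConeSensitivity → ConeScaleCorrector → SubBallisticWindow → GibbsSteadyState → NessUnique → FiniteResponseOfUnique → BoundedResp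
-- earlier Assembly (stmt-AtomisticToContinuum-15095, replaced 2026-08-16T09:41:16Z -> stmt-AtomisticToContinuum-15161): proved by Summit.AtomisticToContinuum.FouriersLaw.Theorems.oddSectorIrreversibility_assembly_proof — WitnessGlue → ClosedConeSensitivity → ConeScaleCorrector → SubBallisticWindow → NessUnique → FiniteResponseOfUnique → BoundedResponseConverges → FouriersLaw
-- earlier Assembly (stmt-AtomisticToContinuum-9149, replaced 2026-08-16T02:18:35Z -> stmt-AtomisticToContinuum-14058): retired by None — NessUnique → FiniteResponseOfUnique → GibbsSteadyState → CurrentVarianceLinear → ResponseDensity → OddResponseBound → BoundedResponseConverges → FouriersLaw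
/-- item stmt-AtomisticToContinuum-15161 · assembly · rank 1 · closed · proved by Summit.AtomisticToContinuum.FouriersLaw.Theorems.oddSectorIrreversibility_assembly_proof @ e3846a160a82 (prover) · by planner
sources: BonettoLebowitzReyBellet2000, CuneoEckmannHairerReyBellet2018
[assembly] WitnessGlue → TapLeakBound → ConeScaleCorrector → SubBallisticWindow → NessUnique →
FiniteResponseOfUnique → BoundedResponseConverges → FouriersLaw — the type of the PROVED crux-only
deciding theorem `closes` (rev 17): `theorem … : Assembly := by unfold Assembly; exact closes`
(Theorems/OddSectorIrreversibilityAssembly.lean, unchanged text, re-elaborates against this body)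
closes the item; concludes the sub-problem Statement decl `FouriersLaw` (D-0027 §2.1). Restates the
rev-11 assembly (stmt-15095, proved) whose chain carried the held E3 in place of P. -/
@[route_item "route-AtomisticToContinuum-OddSectorIrreversibility"]
def Assembly : Prop :=
  WitnessGlue → TapLeakBound → ConeScaleCorrector → SubBallisticWindow → NessUnique → FiniteResponseOfUnique → BoundedResponseConverges → FouriersLaw

-- `Assembly` holds: proved by `Summit.AtomisticToContinuum.FouriersLaw.Theorems.oddSectorIrreversibility_assembly_proof` @ e3846a160a82 (its module imports this route file, so no `_holds` link can be stated here).

-- records of items no longer active in this route (dropped / restated):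
-- earlier OddCorrectorDecay (stmt-AtomisticToContinuum-9139, dropped 2026-08-16T09:03:08Z): refuted by Summit.AtomisticToContinuum.FouriersLaw.Theorems.not_OddCorrectorDecay — ∀ ω₂ lam β γ : ℝ, 0 < ω₂ → 0 < lam → 0 < β → 0 < γ → ∀ T : ℝ, 0 < T → ∃ C : ℝ, ∀ N : ℕ, MeasureTheory.IntegrableOn (fun t : ℝ => Real.sqrt (∫ x, ((∫ y, (∑ i : Fin N, (Literature.MathematicalPhysics.KineticTheory.HeatConduction

/-! D-0027 §2.1 — DECIDING THEOREM (planner-authored via `route open/edit --closes-file`; by planner-rchoice-AtomisticToContinuum-OddSector-4801cdfb-0 2026-08-16T09:41:16Z):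
its hypotheses are this route's items and its conclusion the sub-problem Statement (glue_lint), and it elaborates with this file. -/

/-- D-0027 §2.1 deciding theorem for route OddSectorIrreversibility, rev 17 (route-choice seat 4801cdfb, 2026-08-16; the
crux-only form of rev 11 kept): the route's SEVEN CRUXES imply the sub-problem Statement `FouriersLaw`
(Summits/AtomisticToContinuum/FouriersLaw/Statement.lean), and nothing else is assumed. REV 17 = the E3 route-choice: the held,
misstated tangent cone `ClosedConeSensitivity` (now a settled-negative support edge; Negative lane ZeroFrictionDictionary /
TangentReduction) is no longer a hypothesis; its crux slot carries `TapLeakBound` (P), the N-uniform tap-leak budget of the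
transport-witness pairing `|T⟨∂_{p_b}u⁺, ∂_{p_b}(j_i∘Φ_s)⟩| ≤ C√((|⟨u,J⟩|+Z)Z)(1 + d − s/a)^{-3/2}`, to be split into boundary Hermite
regularity of the even corrector (H1) × a resampled-kick cone of the closed flow (C′) by Gaussian integration by parts. `WitnessGlue` —
the TRANSPORT-WITNESS THEOREM `TapLeakBound → ConeScaleCorrector → SubBallisticWindow → BoundedResponse` (the fixed-N corrector calculus
`CorrectorTheory` is a LEMMA beneath it, `GibbsSteadyState` is proved, weak-NESS uniqueness is `BoundedResponse`'s own antecedent) — turns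
the three N-uniform cruxes P/E1/E2 into length-uniform bounded response along every steady-state family; clause (i) from the PROVED
`pinnedChain_exists_isSteadyState` + `NessUnique`; canonical family by choice; `D₀` from `FiniteResponseOfUnique`; bounded ⇒
convergent-positive by `BoundedResponseConverges`; `κ` := the limit; other families agree for `|δ| < 2T` by uniqueness. Not hypotheses: the
supports `CorrectorTheory`, `GibbsSteadyState` ✓, `BoundedResponse`, `ResponseDensity`, `OddDensityIsCorrector`, the settled-negative edges
`ClosedConeSensitivity` (held) / `OddResponseBound`, and `Assembly` (whose body is this type verbatim). (planner Sketch.lean `closesP`: lean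
check rc 0, 0 sorry, axioms propext/Classical.choice/Quot.sound) -/
@[closes "route-AtomisticToContinuum-OddSectorIrreversibility"] theorem closes : WitnessGlue → TapLeakBound → ConeScaleCorrector → SubBallisticWindow →
    NessUnique → FiniteResponseOfUnique → BoundedResponseConverges → FouriersLaw := by
  intro hW hP hE1 hE2 hU hF hBC
  show Literature.MathematicalPhysics.KineticTheory.HeatConduction.FouriersLaw
  unfold Literature.MathematicalPhysics.KineticTheory.HeatConduction.FouriersLaw
  intro ω₂ lam β γ hω hl hβ hγ
  have hUq := hU ω₂ lam β γ hω hl hβ hγ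
  -- bounded response along every steady-state family (support `BoundedResponse`, delivered by the crux `WitnessGlue`)
  have hB := hW hP hE1 hE2 ω₂ lam β γ hω hl hβ hγ hUq
  have hex : ∀ (N : ℕ) (T_L T_R : ℝ), 0 < T_L → 0 < T_R →
      ∃ μ : MeasureTheory.Measure (Literature.MathematicalPhysics.KineticTheory.HeatConduction.PhaseSpace N),
        (Literature.MathematicalPhysics.KineticTheory.HeatConduction.pinnedChain ω₂ lam β γ).IsSteadyState N T_L T_R μ :=
    fun N T_L T_R h1 h2 =>
      Literature.MathematicalPhysics.KineticTheory.HeatConduction.pinnedChain_exists_isSteadyState hω hl hβ hγ N h1 h2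
  unfold Literature.MathematicalPhysics.KineticTheory.HeatConduction.OscillatorChain.FouriersLawFor
  refine ⟨fun N T_L T_R h1 h2 => ?_, ?_⟩
  · obtain ⟨μ, hμ⟩ := hex N T_L T_R h1 h2
    exact ⟨μ, hμ, fun ν hν => hUq N T_L T_R h1 h2 ν μ hν hμ⟩
  classical
  let μ₀ : (N : ℕ) → ℝ → ℝ →
      MeasureTheory.Measure (Literature.MathematicalPhysics.KineticTheory.HeatConduction.PhaseSpace N) :=
    fun N T_L T_R => if h : 0 < T_L ∧ 0 < T_R then Classical.choose (hex N T_L T_R h.1 h.2) else 0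
  have hμ₀ : ∀ (N : ℕ) (T_L T_R : ℝ), 0 < T_L → 0 < T_R →
      (Literature.MathematicalPhysics.KineticTheory.HeatConduction.pinnedChain ω₂ lam β γ).IsSteadyState N T_L T_R
        (μ₀ N T_L T_R) := by
    intro N T_L T_R h1 h2
    have h12 : 0 < T_L ∧ 0 < T_R := ⟨h1, h2⟩
    simp only [μ₀, dif_pos h12]
    exact Classical.choose_spec (hex N T_L T_R h1 h2)
  have hD : ∀ T : ℝ, 0 < T → ∀ N : ℕ, ∃ D : ℝ,
      Filter.Tendsto (fun δ : ℝ =>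
        (Literature.MathematicalPhysics.KineticTheory.HeatConduction.pinnedChain ω₂ lam β γ).totalCurrent
          (μ₀ N (T + δ / 2) (T - δ / 2)) / δ) (nhdsWithin 0 {(0 : ℝ)}ᶜ) (nhds D) :=
    fun T hT N => hF ω₂ lam β γ hω hl hβ hγ hUq μ₀ hμ₀ T hT N
  let D₀ : ℝ → ℕ → ℝ := fun T N => if hT : 0 < T then Classical.choose (hD T hT N) else 0
  have hD₀ : ∀ T : ℝ, 0 < T → ∀ N : ℕ,
      Filter.Tendsto (fun δ : ℝ =>
        (Literature.MathematicalPhysics.KineticTheory.HeatConduction.pinnedChain ω₂ lam β γ).totalCurrent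
          (μ₀ N (T + δ / 2) (T - δ / 2)) / δ) (nhdsWithin 0 {(0 : ℝ)}ᶜ) (nhds (D₀ T N)) := by
    intro T hT N
    simp only [D₀, dif_pos hT]
    exact Classical.choose_spec (hD T hT N)
  have hbdd : ∀ T : ℝ, 0 < T → BddAbove (Set.range fun N => |D₀ T N|) :=
    fun T hT => hB μ₀ hμ₀ T hT (D₀ T) (hD₀ T hT)
  have hconv : ∀ T : ℝ, 0 < T → ∃ k : ℝ, 0 < k ∧ Filter.Tendsto (D₀ T) Filter.atTop (nhds k) :=
    fun T hT => hBC ω₂ lam β γ hω hl hβ hγ hUq μ₀ hμ₀ T hT (D₀ T) (hD₀ T hT) (hbdd T hT)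
  let κ : ℝ → ℝ := fun T => if hT : 0 < T then Classical.choose (hconv T hT) else 1
  refine ⟨κ, fun T hT => ?_, ?_⟩
  · simp only [κ, dif_pos hT]
    exact (Classical.choose_spec (hconv T hT)).1
  intro μ hμ T hT
  refine ⟨D₀ T, fun N => ?_, ?_⟩
  · have key : ∀ᶠ δ in nhdsWithin (0 : ℝ) {(0 : ℝ)}ᶜ,
        (Literature.MathematicalPhysics.KineticTheory.HeatConduction.pinnedChain ω₂ lam β γ).totalCurrent
            (μ₀ N (T + δ / 2) (T - δ / 2)) / δ =
          (Literature.MathematicalPhysics.KineticTheory.HeatConduction.pinnedChain ω₂ lam β γ).totalCurrent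
            (μ N (T + δ / 2) (T - δ / 2)) / δ := by
      have h2 : ∀ᶠ δ in nhds (0 : ℝ), δ < 2 * T := eventually_lt_nhds (by linarith)
      have h2' : ∀ᶠ δ in nhds (0 : ℝ), -(2 * T) < δ := eventually_gt_nhds (by linarith)
      filter_upwards [mem_nhdsWithin_of_mem_nhds h2, mem_nhdsWithin_of_mem_nhds h2'] with δ hlt hgt
      have ha : 0 < T + δ / 2 := by linarith
      have hb : 0 < T - δ / 2 := by linarith
      rw [hUq N _ _ ha hb _ _ (hμ₀ N _ _ ha hb) (hμ N _ _ ha hb)]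
    exact (hD₀ T hT N).congr' key
  · simp only [κ, dif_pos hT]
    exact (Classical.choose_spec (hconv T hT)).2

end Summit.AtomisticToContinuum.FouriersLaw.Theses.OddSectorIrreversibility
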